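import Literature.MathematicalPhysics.QuantumFieldTheory.Balaban1983to89.B9SectBL2TransferInY
import Literature.MathematicalPhysics.QuantumFieldTheory.Balaban1983to89.B9SectBL2TransferConvY
import Literature.MathematicalPhysics.QuantumFieldTheory.Balaban1983to89.B9Eq38SecondOrderCrossL2

/-!
# `Balaban1983to89.B9SectBL2SecondOrderY` — the SECOND-ORDER (3.46) members at the record (pub-ymgap N06 row 13, (O4) per-member programme,
# `L²` member): every orientation pattern of `∇∇G`, `G∇*∇*` at the base from print's patterns (hin), and print's `∇_{U′U}∇_{U′U}G′`, `G′∇*_{U′U}∇*_{U′U}`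
# at `U′U` from the augmented member (hout), under the DISPLAYED plaquette smallness of the base

T. Bałaban, *Propagators for lattice gauge theories in a background field*, Commun. Math. Phys. **99** (1985) 389–434
[`Balaban1985BackgroundPropagators`, "B9"]; [4] = T. Bałaban, *Propagators and renormalization transformations for lattice gauge
theories. II*, Commun. Math. Phys. **96** (1984) 223–250 [`Balaban1984PropagatorsII`].

statement-level skeleton of published theorems with citation tags; proofs where landed; nothing here is a claim about the
Yang–Mills mass gap

THE PRINTED LOCI.  Theorem 3.1 (3.46) p. 398 (the `L²` entries, members `∇_U∇_UG`, `G∇*_U∇*_U` of weight `1`); p. 398 first remark («we may always replace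
∇_U by ∇*_U, and vice versa, using (3.8)»); p. 403 l.1–9 («all the statements (3.42)–(3.47) of Theorem 3.1 for the operator G′(U′U), of course with
different constants»); (3.70) p. 404, (3.74) p. 405; (3.37) p. 396; p. 404 after (3.69) («|Re(U′U)(∂p) − 1|, |Im(U′U)(∂p)| ≦ O(1)(Mα₀ + α₁)ξ² … follow directly
from (3.35), (3.37)») — the plaquette smallness of the base, DISPLAYED here as `PlaqLawY c_P U` on the transports (its derivation from (3.35) on a cube of the
class is `B9Eq335Plaquette`, b09 lineage; the covering geometry is that lineage's open item); [4] Prop. 2.6 (2.140)–(2.141) p. 247, Lemma 2.1 p. 234.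

WHY THIS FILE (seat dag-n06-c gen 9).  `B9SectBL2TransferInY` reads the record's (3.46) block in print's patterns and supplies every pattern with at most
one difference per side (augmented members 0, 1, 2, 4 at the base); `B9SectBL2TransferConvY` converts the members with at most one difference per side to
`U′U`.  The two second-order members need the plaquette: §1 (hin) every pattern of the words `∇♯_k∇♯_l·G` and `G·∇♯_k∇♯_l` at the base from print's
`∇∇G`, `G∇*∇*`, `∇G`, `G∇*` by the outer switches of `B9Eq38CrossLettersL2` and the inner switches of `B9Eq38SecondOrderCrossL2` (augmented members 3, 5,
completing `l2_KSC₃_base_of_record`); §2 (hout) print's `∇_{U′U,μ}∇_{U′U,ν}G′` and `G′∇*_{U′U,μ}∇*_{U′U,ν}` at `U′U` from the augmented member's block by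
`B9Eq370SecondOrderConversionL2`, which with `hconvL2_words_at` and `l2Block_kernelFamilyS_of_printWords` gives the record's (3.46) block at `U′U` WITHOUT the
displayed second-difference hypotheses of `l2Block_record_at_W_of_KSC₃` — replaced by the single letter law `PlaqLawY`.
Value = per-member bookkeeping toward the Sect.-B frames over the coded carrier; NOT summit progress; N06 is not discharged by this file.
-/

noncomputable section

namespace Literature.MathematicalPhysics.QuantumFieldTheory.Balaban1983to89.B9SectBL2SecondOrderY

open NormedSpace Complex
open Literature.MathematicalPhysics.QuantumFieldTheory.Balaban1983to89
open Literature.MathematicalPhysics.QuantumFieldTheory.Balaban1983to89.B6KLevelCensusIndexV1 (KIdx kGeo)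
open Literature.MathematicalPhysics.QuantumFieldTheory.Balaban1983to89.B6Ineq2142KLevelV1 (β)
open Literature.MathematicalPhysics.QuantumFieldTheory.Balaban1983to89.B6RandomWalk (Triangle254 Ineq261)
open Literature.MathematicalPhysics.QuantumFieldTheory.Balaban1983to89.B6RandomWalkL2 (HasL2Majorant hasL2Majorant_mono)
open Literature.MathematicalPhysics.QuantumFieldTheory.Balaban1983to89.B9Thm34Ext (toB6)
open Literature.MathematicalPhysics.QuantumFieldTheory.Balaban1983to89.B9Ineq347 (ScaleTransfer)
open Literature.MathematicalPhysics.QuantumFieldTheory.Balaban1983to89.B9FromB6 (L2Block pref6_nonneg)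
open Literature.MathematicalPhysics.QuantumFieldTheory.Balaban1983to89.B9Eq39Adjoint (R fluct prodCfg covD covDstar)
open Literature.MathematicalPhysics.QuantumFieldTheory.Balaban1983to89.B9Eq352DivForm (tauB)
open Literature.MathematicalPhysics.QuantumFieldTheory.Balaban1983to89.B9Eq352DivFormLetters (conj)
open Literature.MathematicalPhysics.QuantumFieldTheory.Balaban1983to89.B9Eq352GradLetters (diffLetter)
open Literature.MathematicalPhysics.QuantumFieldTheory.Balaban1983to89.B9Ineq363L2 (hasL2Majorant_rate_mono)
open Literature.MathematicalPhysics.QuantumFieldTheory.Balaban1983to89.B9SectBCodedCarrier (CCfg)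
open Literature.MathematicalPhysics.QuantumFieldTheory.Balaban1983to89.B9Eq360DeltaPrimeAY (AfldY mulY chartA UboxY_mulY_fluct)
open Literature.MathematicalPhysics.QuantumFieldTheory.Balaban1983to89.B9PinMembersKLevelV1 (MemberY geo9Y bg9Y)
open Literature.MathematicalPhysics.QuantumFieldTheory.Balaban1983to89.B9SectBGpLettersY (GVal coordC expAC blkC stencilF_blkC stencilB_blkC
  norm_le_one_and_inv_of_mem letters_base_of_gVal)
open Literature.MathematicalPhysics.QuantumFieldTheory.Balaban1983to89.B9SectBGpFrameCodedY (codingYx CplxLettersY)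
open Literature.MathematicalPhysics.QuantumFieldTheory.Balaban1983to89.B9SectBGpReadingsY (etaS_eq_eta)
open Literature.MathematicalPhysics.QuantumFieldTheory.Balaban1983to89.B9SectBGpTransferConvY (letters337_of_cplxLettersY)
open Literature.MathematicalPhysics.QuantumFieldTheory.Balaban1983to89.B9SectBL2DictionaryY (wordSL wordL e6 dirS l2AugS KSC₃ KSC₃_l2 l2OfY_wordL
  l2AugS_le_of_hasL2Majorant_wordL hasL2Majorant_wordL_of_l2AugS)
open Literature.MathematicalPhysics.QuantumFieldTheory.Balaban1983to89.B9SectBL2TransferInY (hasL2Majorant_recordWords_of_l2Block hasL2Majorant_allPatterns_of_l2Block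
  crossConstL2 crossConstL2_nonneg l2Block_kernelFamilyS_of_printWords)
open Literature.MathematicalPhysics.QuantumFieldTheory.Balaban1983to89.B9SectBL2TransferConvY (hconvL2_words_at convConstL2 cDef cDef_nonneg)
open Literature.MathematicalPhysics.QuantumFieldTheory.Balaban1983to89.B9Eq38CrossLettersL2 (hasL2Majorant_cross_left hasL2Majorant_cross_right)
open Literature.MathematicalPhysics.QuantumFieldTheory.Balaban1983to89.B9Eq38SecondOrderCrossL2 (hasL2Majorant_cross2_left_inner hasL2Majorant_cross2_right_inner
  scaleTransfer_one)
open Literature.MathematicalPhysics.QuantumFieldTheory.Balaban1983to89.B9Eq370SecondOrderConversionL2 (hasL2Majorant_diffLetter2_prodCfg_mul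
  hasL2Majorant_mul_diffLetter2_prodCfg conv2ConstL conv2ConstR le_of_scaleTransfer sigma_two_of_scaleTransfer)
open Literature.MathematicalPhysics.QuantumFieldTheory.Balaban1983to89.B9GeoLemma21KLevelV1 (geo9Y_dist_triangle geo9Y_len_pos geo9K_eta_pos geo9K_one_le_L)
open Literature.MathematicalPhysics.QuantumFieldTheory.Balaban1983to89.B9RWSums347DefiniteFacesWindow (geo9Y_dist_nonneg)
open Literature.MathematicalPhysics.QuantumFieldTheory.Balaban1983to89.Node00 (SiteY BlkY IBondY CfgY BallY SiteOpY SiteParY UboxY shiftY cdS cdsS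
  liftY l2OfY etaS kernelFamilyS GpY)

variable {𝔸 : Type} [NormedRing 𝔸] [NormedAlgebra ℂ 𝔸] [CompleteSpace 𝔸] [NormOneClass 𝔸] [FiniteDimensional ℝ 𝔸]
variable {d ℓ : ℕ} {hd : 1 ≤ d + 1} {hL : Odd (ℓ + 1) ∧ 1 < ℓ + 1} {b₀ b₁ : ℝ} {Mstar : ℕ}

/-! ## §0  Record facts: commuting shifts, the plaquette law, the (3.37) second clause in the frames' letters -/

section Facts

variable (G : Subgroup 𝔸ˣ) (x : MemberY d ℓ hd hL b₀ b₁ Mstar) (par : SiteParY 𝔸 x.toKIdx) (ιB : BlkY x.toKIdx → IBondY x.toKIdx)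

omit [NormedAlgebra ℂ 𝔸] [CompleteSpace 𝔸] [NormOneClass 𝔸] [FiniteDimensional ℝ 𝔸] in
/-- the lattice translations of NODE 00's site sector commute. [cite: Balaban1985BackgroundPropagators, (3.3) p.390, bookkeeping] -/
theorem shiftY_comm (μ ν : Fin (d + 1)) (z : SiteY x.toKIdx) : shiftY x.toKIdx μ (shiftY x.toKIdx ν z) = shiftY x.toKIdx ν (shiftY x.toKIdx μ z) := by
  show B6MultiLevelTorusOperator.tshift _ _ (B6MultiLevelTorusOperator.tshift _ _ z) = B6MultiLevelTorusOperator.tshift _ _ (B6MultiLevelTorusOperator.tshift _ _ z)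
  rw [B6MultiLevelTorusOperator.tshift_tshift, B6MultiLevelTorusOperator.tshift_tshift, add_comm (B6MultiLevelTorusOperator.unitVec ν)]

/-- **THE PLAQUETTE SMALLNESS OF A CONFIGURATION, IN THE TRANSPORTED FORM THE CONVERSIONS USE** (print p. 404 after (3.69): «|Re(U′U)(∂p) − 1|,
|Im(U′U)(∂p)| ≦ O(1)(Mα₀ + α₁)ξ² … follow directly from (3.35), (3.37)», `ξ = L^{−j} = η/(Lʲη)`): for every plaquette `p = (z; μ, ν)` the two transports
around `p` differ by at most `c_P·(η/ℓ(y(z)))²` in operator norm on `𝔸`: `‖R(U_μ(z)U_ν(z+e_μ))X − R(U_ν(z)U_μ(z+e_ν))X‖ ≦ c_P(η/ℓ(y(z)))²‖X‖`.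
A DISPLAYED hypothesis of this file (derivable from (3.35) on a cube of the class containing `p`, `B9Eq335Plaquette`).
[cite: Balaban1985BackgroundPropagators, p.404 (after (3.69)), (3.35) p.396] -/
def PlaqLawY (cP : ℝ) (U : CfgY 𝔸 x.toKIdx) : Prop :=
  ∀ (μ ν : Fin (d + 1)) (z : SiteY x.toKIdx) (X : 𝔸),
    ‖R (UboxY x.toKIdx U μ z * UboxY x.toKIdx U ν (shiftY x.toKIdx μ z)) X - R (UboxY x.toKIdx U ν z * UboxY x.toKIdx U μ (shiftY x.toKIdx ν z)) X‖
      ≤ cP * ((kGeo x.toKIdx).eta * ((geo9Y x).len (blkC x.toKIdx ιB z))⁻¹) ^ 2 * ‖X‖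

omit [NormOneClass 𝔸] [FiniteDimensional ℝ 𝔸] in
/-- the (3.37) second clause (`|∇^η_U A| < α₁(Lʲη)⁻²`, clause 4 of `CplxLettersY`) in the frames' letters `UboxY U`, `chartA a`.
[cite: Balaban1985BackgroundPropagators, (3.37) p.396] -/
theorem letters337b_of_cplxLettersY {Cq β' α : ℝ} (hβα : β' ≤ α) {U : CfgY 𝔸 x.toKIdx} (hU : GVal G x.toKIdx U) {a : AfldY 𝔸 x.toKIdx}
    (h : CplxLettersY G x par ιB Cq β' U a) (μ ν : Fin (d + 1)) (z : SiteY x.toKIdx) :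
    ‖((((kGeo x.toKIdx).eta : ℂ))⁻¹) • covD (shiftY x.toKIdx) (UboxY x.toKIdx U) μ (chartA x.toKIdx a ν) z‖
      ≤ α * ((geo9Y x).len (blkC x.toKIdx ιB z) ^ 2)⁻¹ := by
  have hco : coordC G x.toKIdx (.base U) = UboxY x.toKIdx U := (letters_base_of_gVal G x.toKIdx par hU).1
  have hexp : expAC x.toKIdx (.base U) (.mult a) = chartA x.toKIdx a := rfl
  obtain ⟨-, -, -, h4, -, -, -⟩ := h
  rw [hco, hexp] at h4
  exact (h4 μ ν z).trans (mul_le_mul_of_nonneg_right hβα (inv_nonneg.mpr (sq_nonneg _)))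

omit [NormedAlgebra ℂ 𝔸] [CompleteSpace 𝔸] [NormOneClass 𝔸] [FiniteDimensional ℝ 𝔸] in
/-- `η ≦ ℓ(y)` for every block (`ℓ(y) = L^{j}η`, `L ≧ 1`). [cite: Balaban1985BackgroundPropagators, (3.16) p.394, bookkeeping] -/
theorem eta_le_len (y : (geo9Y x).Site) : (kGeo x.toKIdx).eta ≤ (geo9Y x).len y := by
  show (geo9Y x).eta ≤ (geo9Y x).L ^ (geo9Y x).scale y * (geo9Y x).eta
  exact le_mul_of_one_le_left (geo9K_eta_pos x.toKIdx).le (one_le_pow₀ (geo9K_one_le_L x.toKIdx))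

end Facts

/-! ## §1  ★★ hin: every orientation pattern of the second-order words at the base from print's patterns -/

section Hin

variable (G : Subgroup 𝔸ˣ) (x : MemberY d ℓ hd hL b₀ b₁ Mstar) (par : SiteParY 𝔸 x.toKIdx) {ι : Type} [Fintype ι] [DecidableEq ι]
  (b : Module.Basis ι ℝ 𝔸) (ιB : BlkY x.toKIdx → IBondY x.toKIdx) [Fintype (geo9Y x).Site] [DecidableEq (geo9Y x).Site]

/-- ★ **THE CONSTANT OF THE SECOND-ORDER CROSS PATTERNS** (member-independent): with `M = M₂·Sb·sι`, `d₀ = 2(d+1)`, `c₁ = c₁(dL, δ₀, 1/12)`, the outer factor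
`g_X = 1 + M e^{δ₀d₀}·Λ·c₁` of `B9SectBL2TransferInY.crossConstL2` and the inner factor `g_I = 1 + c₁M·(e^{δ₀d₀}Λ + c_P·(Λe^{δ₀d₀/12})·e^{2δ₀d₀}·Λ)`:
`g_X·g_I·(sι·M₂·Sb)·B₀`. [cite: Balaban1985BackgroundPropagators, p.398 (first remark), p.403 l.1–9 («of course with different constants»), bookkeeping] -/
def cross2ConstL2 (cP M₂ Sb sι : ℝ) (d dL : ℕ) (δ₀ Λ B₀ : ℝ) : ℝ :=
  (1 + ((1 : ℝ) ^ 2 * M₂ * Sb * sι * Real.exp (δ₀ * (2 * ((d : ℝ) + 1)))) * Λ * B6.c1 dL δ₀ (1 / 12)) *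
    (1 + B6.c1 dL δ₀ (1 / 12) * M₂ * Sb * sι *
      ((1 : ℝ) ^ 2 * Real.exp (δ₀ * (2 * ((d : ℝ) + 1))) * Λ
        + (1 : ℝ) ^ 4 * cP * (Λ * Real.exp (1 / 12 * δ₀ * (2 * ((d : ℝ) + 1)))) * Real.exp (δ₀ * (2 * (2 * ((d : ℝ) + 1)))) * Λ)) *
    ((sι * M₂ * Sb) * B₀)

omit [NormedRing 𝔸] [NormedAlgebra ℂ 𝔸] [CompleteSpace 𝔸] [NormOneClass 𝔸] [FiniteDimensional ℝ 𝔸] in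
/-- `cross2ConstL2 ≧ 0`. [cite: Balaban1985BackgroundPropagators, p.403 l.1–9, bookkeeping] -/
theorem cross2ConstL2_nonneg {cP M₂ Sb sι : ℝ} (hcP : 0 ≤ cP) (hM₂ : 0 ≤ M₂) (hSb : 0 ≤ Sb) (hsι : 0 ≤ sι) (d dL : ℕ) (δ₀ : ℝ) {Λ B₀ : ℝ}
    (hΛ : 0 ≤ Λ) (hB₀ : 0 ≤ B₀) : 0 ≤ cross2ConstL2 cP M₂ Sb sι d dL δ₀ Λ B₀ := by
  have := B6RandomWalk.c1_nonneg dL δ₀ (1 / 12)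
  unfold cross2ConstL2; positivity

omit [NormOneClass 𝔸] in
/-- ★★ **EVERY ORIENTATION PATTERN OF THE SECOND-ORDER WORDS AT THE BASE** (p. 398 first remark, twice): at a member with a section `ιB` of `β`, unit-norm
structure group, a real basis, Lemma 2.1 of [4] at `(δ₀, 1/12)`, the scale transfers of `ℓ` and `ℓ⁻²` with one constant `Λ ≧ 1`, and the plaquette law
`PlaqLawY c_P U` of the `G`-valued base `U`: if the record `kernelFamilyS … id (GpY par) par` has the (3.46) block `(B₀, δ₀)` at `U`, then for ALL
`k, l ∈ κ ⊕ κ` the words `∇♯_k∇♯_l·G` (index 3) and `G·∇♯_k∇♯_l` (index 5) have block-`ℓ²` majorants `cross2ConstL2 · pref6_n(ℓ) · e^{−(δ₀/2)d}` —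
print's `∇∇G`, `G∇*∇*` read from the record, the inner letter switched by `B9Eq38SecondOrderCrossL2` (the plaquette), the outer by `B9Eq38CrossLettersL2`.
[cite: Balaban1985BackgroundPropagators, p.398 (first remark), Thm 3.1 (3.46) p.398, (3.8) p.392, p.404 (after (3.69)); Balaban1984PropagatorsII, Prop. 2.6 (2.140)–(2.141) p.247, Lemma 2.1 p.234] -/
theorem hasL2Majorant_secondPatterns_of_l2Block (hι : ∀ s : BlkY x.toKIdx, β x.toKIdx.hN x.toKIdx.D x.toKIdx.hk (ιB s) = s)
    (hG1 : ∀ u : 𝔸ˣ, u ∈ G → ‖(u : 𝔸)‖ ≤ 1) {M₂ : ℝ} (hM₂ : 0 ≤ M₂) (hrepr : ∀ (v : 𝔸) (j : ι), |b.repr v j| ≤ M₂ * ‖v‖)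
    {δ₀ : ℝ} (hδ₀ : 0 < δ₀) {dL : ℕ} (h261 : Ineq261 dL (toB6 (geo9Y x) (0 : ℝ) True) δ₀ (1 / 12)) {Λ : ℝ} (hΛ : 1 ≤ Λ)
    (hT1 : ScaleTransfer (geo9Y x) δ₀ (1 / 12) Λ (fun a => (geo9Y x).len a))
    (hTi2 : ScaleTransfer (geo9Y x) δ₀ (1 / 12) Λ (fun a => ((geo9Y x).len a)⁻¹ ^ 2))
    {cP : ℝ} (hcP : 0 ≤ cP) {B₀ : ℝ} (hB₀ : 0 ≤ B₀) {U : CfgY 𝔸 x.toKIdx} (hU : GVal G x.toKIdx U) (hplaq : PlaqLawY x ιB cP U)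
    (hL2 : L2Block (kernelFamilyS x.toKIdx (bg9Y 𝔸 G x) (fun U => U) (GpY x.toKIdx par) par) B₀ δ₀ U) :
    (∀ k l : Fin (d + 1) ⊕ Fin (d + 1), HasL2Majorant (g := toB6 (geo9Y x) (0 : ℝ) True) (fun p : SiteY x.toKIdx × ι => blkC x.toKIdx ιB p.1)
        (conj b (wordL x.toKIdx (GpY x.toKIdx par) U U (kGeo x.toKIdx).eta 3 k l))
        (fun a a' => cross2ConstL2 cP M₂ (∑ j, ‖b j‖) (Real.sqrt (Fintype.card ι)) d dL δ₀ Λ B₀ * B9.pref6 ((geo9Y x).len a) 3 *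
          Real.exp (-(δ₀ / 2 * (geo9Y x).dist a a')))) ∧
      (∀ k l : Fin (d + 1) ⊕ Fin (d + 1), HasL2Majorant (g := toB6 (geo9Y x) (0 : ℝ) True) (fun p : SiteY x.toKIdx × ι => blkC x.toKIdx ιB p.1)
        (conj b (wordL x.toKIdx (GpY x.toKIdx par) U U (kGeo x.toKIdx).eta 5 k l))
        (fun a a' => cross2ConstL2 cP M₂ (∑ j, ‖b j‖) (Real.sqrt (Fintype.card ι)) d dL δ₀ Λ B₀ * B9.pref6 ((geo9Y x).len a) 5 *
          Real.exp (-(δ₀ / 2 * (geo9Y x).dist a a')))) := by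
  -- constants and geometry
  set η : ℝ := (kGeo x.toKIdx).eta with hηdef
  have hη0 : 0 < η := geo9K_eta_pos x.toKIdx
  set Sb : ℝ := ∑ j, ‖b j‖ with hSbdef
  set sι : ℝ := Real.sqrt (Fintype.card ι) with hsι
  set cL : ℝ := sι * M₂ * Sb with hcL
  set Bin : ℝ := cL * B₀ with hBin
  set c₁ : ℝ := B6.c1 dL δ₀ (1 / 12) with hc₁
  set d₀ : ℝ := 2 * ((d : ℝ) + 1) with hd₀
  set σ₁ : ℝ := Λ * Real.exp (1 / 12 * δ₀ * d₀) with hσ₁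
  set gX : ℝ := 1 + ((1 : ℝ) ^ 2 * M₂ * Sb * sι * Real.exp (δ₀ * d₀)) * Λ * c₁ with hgX
  set gI : ℝ := 1 + c₁ * M₂ * Sb * sι * ((1 : ℝ) ^ 2 * Real.exp (δ₀ * d₀) * Λ + (1 : ℝ) ^ 4 * cP * σ₁ * Real.exp (δ₀ * (2 * d₀)) * Λ) with hgI
  set Bx : ℝ := cross2ConstL2 cP M₂ Sb sι d dL δ₀ Λ B₀ with hBxdef
  have hSb : 0 ≤ Sb := Finset.sum_nonneg fun i _ => norm_nonneg _
  have hsι0 : 0 ≤ sι := Real.sqrt_nonneg _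
  have hcL0 : 0 ≤ cL := by positivity
  have hBin0 : 0 ≤ Bin := mul_nonneg hcL0 hB₀
  have hΛ0 : 0 ≤ Λ := le_trans zero_le_one hΛ
  have hc₁0 : 0 ≤ c₁ := B6RandomWalk.c1_nonneg dL δ₀ (1 / 12)
  have hσ₁0 : 0 ≤ σ₁ := by positivity
  have hgX1 : 1 ≤ gX := by rw [hgX]; exact le_add_of_nonneg_right (by positivity)
  have hgX0 : 0 ≤ gX := le_trans zero_le_one hgX1
  have hgI1 : 1 ≤ gI := by rw [hgI]; exact le_add_of_nonneg_right (by positivity)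
  have hgI0 : 0 ≤ gI := le_trans zero_le_one hgI1
  have hBx : Bx = gX * gI * Bin := by rw [hBxdef, hgX, hgI, hσ₁, hBin, hcL, hc₁, hd₀]; rfl
  have hdnn : ∀ y y' : (geo9Y x).Site, 0 ≤ (geo9Y x).dist y y' := geo9Y_dist_nonneg x
  have htri : Triangle254 (toB6 (geo9Y x) (0 : ℝ) True) := fun p q r => geo9Y_dist_triangle x p q r
  have htri' : ∀ p q r : (geo9Y x).Site, (geo9Y x).dist p r ≤ (geo9Y x).dist p q + (geo9Y x).dist q r := fun p q r => geo9Y_dist_triangle x p q r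
  have hlen : ∀ y : (geo9Y x).Site, 0 < (geo9Y x).len y := geo9Y_len_pos x
  have hwℓ : ∀ p : (geo9Y x).Site, 0 ≤ (geo9Y x).len p := fun p => (hlen p).le
  have hd₀F : ∀ (μ : Fin (d + 1)) (z : SiteY x.toKIdx), (geo9Y x).dist (blkC x.toKIdx ιB z) (blkC x.toKIdx ιB (shiftY x.toKIdx μ z)) ≤ d₀ :=
    fun μ z => stencilF_blkC x.toKIdx ιB hι μ z
  have hd₀B : ∀ (μ : Fin (d + 1)) (z : SiteY x.toKIdx), (geo9Y x).dist (blkC x.toKIdx ιB z) (blkC x.toKIdx ιB ((shiftY x.toKIdx μ).symm z)) ≤ d₀ :=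
    fun μ z => stencilB_blkC x.toKIdx ιB hι μ z
  have hd₀FB : ∀ (μ : Fin (d + 1)) (z : SiteY x.toKIdx), (geo9Y x).dist (blkC x.toKIdx ιB z) (blkC x.toKIdx ιB (shiftY x.toKIdx μ z)) ≤ d₀ ∧
      (geo9Y x).dist (blkC x.toKIdx ιB z) (blkC x.toKIdx ιB ((shiftY x.toKIdx μ).symm z)) ≤ d₀ := fun μ z => ⟨hd₀F μ z, hd₀B μ z⟩
  have hρu : ∀ (μ : Fin (d + 1)) (z : SiteY x.toKIdx), ‖((UboxY x.toKIdx U μ z : 𝔸ˣ) : 𝔸)‖ ≤ 1 ∧ ‖(((UboxY x.toKIdx U μ z)⁻¹ : 𝔸ˣ) : 𝔸)‖ ≤ 1 :=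
    fun μ z => norm_le_one_and_inv_of_mem G hG1 (hU μ _ : UboxY x.toKIdx U μ z ∈ G)
  have hαδ : 0 ≤ 1 / 12 * δ₀ := by positivity
  have hT0 : ScaleTransfer (geo9Y x) δ₀ (1 / 12) Λ (fun _ => (1 : ℝ)) := fun y y' => by
    rw [mul_one, mul_one]
    have : Real.exp (-(1 / 12 * δ₀ * (geo9Y x).dist y y')) ≤ 1 := Real.exp_le_one_iff.2 (by nlinarith [hdnn y y', hδ₀.le])
    exact this.trans hΛ
  have heta : ∀ y : (geo9Y x).Site, η ≤ (geo9Y x).len y := eta_le_len x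
  have hcomm : ∀ (μ ν : Fin (d + 1)) (z : SiteY x.toKIdx), shiftY x.toKIdx μ (shiftY x.toKIdx ν z) = shiftY x.toKIdx ν (shiftY x.toKIdx μ z) :=
    shiftY_comm x
  -- the one-step backward scale comparability from the transfer of `ℓ⁻²`
  have hσ : ∀ (ν : Fin (d + 1)) (z : SiteY x.toKIdx), ((geo9Y x).len (blkC x.toKIdx ιB ((shiftY x.toKIdx ν).symm z)))⁻¹ ^ 2
      ≤ σ₁ * ((geo9Y x).len (blkC x.toKIdx ιB z))⁻¹ ^ 2 := fun ν z =>
    le_of_scaleTransfer (w := fun a => ((geo9Y x).len a)⁻¹ ^ 2) hTi2 hαδ (hd₀B ν z) (pow_nonneg (inv_nonneg.mpr (hlen _).le) _)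
  have hplaq' : ∀ (μ ν : Fin (d + 1)) (z : SiteY x.toKIdx) (X : 𝔸),
      ‖R (UboxY x.toKIdx U μ z * UboxY x.toKIdx U ν (shiftY x.toKIdx μ z)) X - R (UboxY x.toKIdx U ν z * UboxY x.toKIdx U μ (shiftY x.toKIdx ν z)) X‖
        ≤ cP * (η * ((geo9Y x).len (blkC x.toKIdx ιB z))⁻¹) ^ 2 * ‖X‖ := fun μ ν z X => hplaq μ ν z X
  -- the letters
  set Gu : Module.End ℝ (SiteY x.toKIdx → 𝔸) := (η ^ 2) • (GpY x.toKIdx par U).restrictScalars ℝ with hGu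
  set D : Fin (d + 1) ⊕ Fin (d + 1) → Module.End ℝ (SiteY x.toKIdx → 𝔸) := fun k => diffLetter (shiftY x.toKIdx) (UboxY x.toKIdx U) (((η : ℂ))⁻¹) k
    with hD
  -- READ the record: print's patterns, rate δ₀, constant Bin
  have hK : ∀ (n : Fin 6) (p q : (geo9Y x).Site), (Real.sqrt (Fintype.card ι) * M₂ * ∑ j, ‖b j‖) * B₀ * B9.pref6 ((geo9Y x).len p) n *
      Real.exp (-(δ₀ * (geo9Y x).dist p q)) = Bin * B9.pref6 ((geo9Y x).len p) n * Real.exp (-(δ₀ * (geo9Y x).dist p q)) := fun n p q => by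
    rw [hBin, hcL, hsι, hSbdef]
  have rr := fun μ ν => hasL2Majorant_recordWords_of_l2Block x ιB b hι hM₂ hrepr (0 : ℝ) True (B := bg9Y 𝔸 G x) (fun U => U) (GpY x.toKIdx par) par hB₀
    hL2 μ ν
  have r1 : ∀ μ, HasL2Majorant (g := toB6 (geo9Y x) (0 : ℝ) True) (fun p : SiteY x.toKIdx × ι => blkC x.toKIdx ιB p.1) (conj b (D (Sum.inl μ)) * conj b Gu)
      (fun p q => Bin * (geo9Y x).len p * Real.exp (-(δ₀ * (geo9Y x).dist p q))) := fun μ => by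
    have h : HasL2Majorant (g := toB6 (geo9Y x) (0 : ℝ) True) (fun p : SiteY x.toKIdx × ι => blkC x.toKIdx ιB p.1) (conj b (D (Sum.inl μ) * Gu))
        (fun a a' => (Real.sqrt (Fintype.card ι) * M₂ * ∑ j, ‖b j‖) * B₀ * B9.pref6 ((geo9Y x).len a) 1 * Real.exp (-(δ₀ * (geo9Y x).dist a a'))) :=
      (rr μ μ).1
    rw [B9Eq352DivFormLetters.conj_mul] at h
    exact hasL2Majorant_mono (g := toB6 (geo9Y x) (0 : ℝ) True) _ h fun p q => le_of_eq (by rw [hK]; rfl)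
  have r2 : ∀ μ, HasL2Majorant (g := toB6 (geo9Y x) (0 : ℝ) True) (fun p : SiteY x.toKIdx × ι => blkC x.toKIdx ιB p.1) (conj b Gu * conj b (D (Sum.inr μ)))
      (fun p q => Bin * (geo9Y x).len p * Real.exp (-(δ₀ * (geo9Y x).dist p q))) := fun μ => by
    have h : HasL2Majorant (g := toB6 (geo9Y x) (0 : ℝ) True) (fun p : SiteY x.toKIdx × ι => blkC x.toKIdx ιB p.1) (conj b (Gu * D (Sum.inr μ)))
        (fun a a' => (Real.sqrt (Fintype.card ι) * M₂ * ∑ j, ‖b j‖) * B₀ * B9.pref6 ((geo9Y x).len a) 2 * Real.exp (-(δ₀ * (geo9Y x).dist a a'))) :=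
      (rr μ μ).2.1
    rw [B9Eq352DivFormLetters.conj_mul] at h
    exact hasL2Majorant_mono (g := toB6 (geo9Y x) (0 : ℝ) True) _ h fun p q => le_of_eq (by rw [hK]; rfl)
  have r3 : ∀ μ ν, HasL2Majorant (g := toB6 (geo9Y x) (0 : ℝ) True) (fun p : SiteY x.toKIdx × ι => blkC x.toKIdx ιB p.1)
      (conj b (D (Sum.inl μ)) * conj b (D (Sum.inl ν)) * conj b Gu) (fun p q => Bin * 1 * Real.exp (-(δ₀ * (geo9Y x).dist p q))) := fun μ ν => by
    have h : HasL2Majorant (g := toB6 (geo9Y x) (0 : ℝ) True) (fun p : SiteY x.toKIdx × ι => blkC x.toKIdx ιB p.1) (conj b (D (Sum.inl μ) * D (Sum.inl ν) * Gu))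
        (fun a a' => (Real.sqrt (Fintype.card ι) * M₂ * ∑ j, ‖b j‖) * B₀ * B9.pref6 ((geo9Y x).len a) 3 * Real.exp (-(δ₀ * (geo9Y x).dist a a'))) :=
      (rr μ ν).2.2.1
    rw [B9Eq352DivFormLetters.conj_mul, B9Eq352DivFormLetters.conj_mul] at h
    exact hasL2Majorant_mono (g := toB6 (geo9Y x) (0 : ℝ) True) _ h fun p q => le_of_eq (by rw [hK]; rfl)
  have r5 : ∀ μ ν, HasL2Majorant (g := toB6 (geo9Y x) (0 : ℝ) True) (fun p : SiteY x.toKIdx × ι => blkC x.toKIdx ιB p.1)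
      (conj b Gu * conj b (D (Sum.inr μ)) * conj b (D (Sum.inr ν))) (fun p q => Bin * 1 * Real.exp (-(δ₀ * (geo9Y x).dist p q))) := fun μ ν => by
    have h : HasL2Majorant (g := toB6 (geo9Y x) (0 : ℝ) True) (fun p : SiteY x.toKIdx × ι => blkC x.toKIdx ιB p.1) (conj b (Gu * D (Sum.inr μ) * D (Sum.inr ν)))
        (fun a a' => (Real.sqrt (Fintype.card ι) * M₂ * ∑ j, ‖b j‖) * B₀ * B9.pref6 ((geo9Y x).len a) 5 * Real.exp (-(δ₀ * (geo9Y x).dist a a'))) :=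
      (rr μ ν).2.2.2.2
    rw [B9Eq352DivFormLetters.conj_mul, B9Eq352DivFormLetters.conj_mul] at h
    exact hasL2Majorant_mono (g := toB6 (geo9Y x) (0 : ℝ) True) _ h fun p q => le_of_eq (by rw [hK]; rfl)
  -- rates
  set ρ₁ : ℝ := 5 * δ₀ / 6 with hρ₁
  set ρ₂ : ℝ := 2 * δ₀ / 3 with hρ₂
  have hρ₁0 : 0 ≤ ρ₁ := by rw [hρ₁]; positivity
  have hρ₂0 : 0 ≤ ρ₂ := by rw [hρ₂]; positivity
  have hr₁ : ρ₁ + (1 / 12 + 1 / 12) * δ₀ ≤ δ₀ := by rw [hρ₁]; linarith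
  have hρ₁δ : ρ₁ ≤ δ₀ := by rw [hρ₁]; linarith
  have hr₂ : ρ₂ + (1 / 12 + 1 / 12) * δ₀ ≤ ρ₁ := by rw [hρ₁, hρ₂]; linarith
  have hρ₂₁ : ρ₂ ≤ ρ₁ := by rw [hρ₁, hρ₂]; linarith
  -- the outer and inner step constants are bounded by `g_X`, `g_I` times the input constant (rates `≦ δ₀`)
  have hexp1 : ∀ r : ℝ, r ≤ δ₀ → Real.exp (r * d₀) ≤ Real.exp (δ₀ * d₀) := fun r hr =>
    Real.exp_le_exp.2 (mul_le_mul_of_nonneg_right hr (by rw [hd₀]; positivity))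
  have hexp2 : ∀ r : ℝ, r ≤ δ₀ → Real.exp (r * (2 * d₀)) ≤ Real.exp (δ₀ * (2 * d₀)) := fun r hr =>
    Real.exp_le_exp.2 (mul_le_mul_of_nonneg_right hr (by rw [hd₀]; positivity))
  have hstep : ∀ (r Bc : ℝ), r ≤ δ₀ → 0 ≤ Bc →
      (1 : ℝ) ^ 2 * M₂ * (∑ i, ‖b i‖) * Real.sqrt (Fintype.card ι) * Real.exp (r * d₀) * Λ * B6.c1 dL δ₀ (1 / 12) * Bc ≤ gX * Bc := by
    intro r Bc hr hBc
    have h1 : (1 : ℝ) ^ 2 * M₂ * (∑ i, ‖b i‖) * Real.sqrt (Fintype.card ι) * Real.exp (r * d₀) * Λ * B6.c1 dL δ₀ (1 / 12)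
        ≤ (1 : ℝ) ^ 2 * M₂ * Sb * sι * Real.exp (δ₀ * d₀) * Λ * c₁ := by
      rw [← hSbdef, ← hsι, ← hc₁]
      exact mul_le_mul_of_nonneg_right (mul_le_mul_of_nonneg_right (mul_le_mul_of_nonneg_left (hexp1 r hr) (by positivity)) hΛ0) hc₁0
    have h2 : (1 : ℝ) ^ 2 * M₂ * Sb * sι * Real.exp (δ₀ * d₀) * Λ * c₁ ≤ gX := by rw [hgX]; linarith
    exact mul_le_mul_of_nonneg_right (h1.trans h2) hBc
  have hstepI : ∀ (r Bc : ℝ), r ≤ δ₀ → 0 ≤ Bc →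
      (B6.c1 dL δ₀ (1 / 12) * M₂ * (∑ i, ‖b i‖) * Real.sqrt (Fintype.card ι)
        * ((1 : ℝ) ^ 2 * Real.exp (r * d₀) * Λ + (1 : ℝ) ^ 4 * cP * σ₁ * Real.exp (r * (2 * d₀)) * Λ)) * Bc ≤ gI * Bc := by
    intro r Bc hr hBc
    refine mul_le_mul_of_nonneg_right ?_ hBc
    rw [← hSbdef, ← hsι, ← hc₁, hgI]
    have hin : (1 : ℝ) ^ 2 * Real.exp (r * d₀) * Λ + (1 : ℝ) ^ 4 * cP * σ₁ * Real.exp (r * (2 * d₀)) * Λ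
        ≤ (1 : ℝ) ^ 2 * Real.exp (δ₀ * d₀) * Λ + (1 : ℝ) ^ 4 * cP * σ₁ * Real.exp (δ₀ * (2 * d₀)) * Λ :=
      add_le_add (mul_le_mul_of_nonneg_right (mul_le_mul_of_nonneg_left (hexp1 r hr) (by positivity)) hΛ0)
        (mul_le_mul_of_nonneg_right (mul_le_mul_of_nonneg_left (hexp2 r hr) (by positivity)) hΛ0)
    have h0 : 0 ≤ c₁ * M₂ * Sb * sι := by positivity
    have := mul_le_mul_of_nonneg_left hin h0
    linarith
  -- WORD 3.  inner switch (inl μ, inr ν) at rate ρ₁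
  have w3_li : ∀ μ ν, HasL2Majorant (g := toB6 (geo9Y x) (0 : ℝ) True) (fun p : SiteY x.toKIdx × ι => blkC x.toKIdx ιB p.1)
      (conj b (D (Sum.inl μ)) * conj b (D (Sum.inr ν)) * conj b Gu) (fun p q => (gI * Bin) * 1 * Real.exp (-(ρ₁ * (geo9Y x).dist p q))) := fun μ ν => by
    have h := hasL2Majorant_cross2_left_inner b (shiftY x.toKIdx) (UboxY x.toKIdx U) (Rr := (0 : ℝ)) (H := True) (g := geo9Y x)
      (fun z => blkC x.toKIdx ιB z) dL hη0 1 cP σ₁ d₀ M₂ δ₀ δ₀ (1 / 12) (1 / 12) ρ₁ Λ Λ Bin hcP hσ₁0 hδ₀.le hM₂ hBin0 hΛ0 hΛ0 hρ₁0 hr₁ hρ₁δ hrepr hdnn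
      htri hlen h261 hT0 hT1 μ ν (hcomm μ ν) hρu (hplaq' μ ν) hd₀FB (hσ ν) heta (Gp := conj b Gu) (r3 μ ν) (r1 ν)
    exact hasL2Majorant_mono (g := toB6 (geo9Y x) (0 : ℝ) True) _ h fun p q =>
      mul_le_mul_of_nonneg_right (mul_le_mul_of_nonneg_right (hstepI δ₀ Bin le_rfl hBin0) zero_le_one) (Real.exp_nonneg _)
  -- outer switch (inr μ, inl ν) at rate ρ₁ and (inr μ, inr ν) at rate ρ₂
  have w3_rl : ∀ μ ν, HasL2Majorant (g := toB6 (geo9Y x) (0 : ℝ) True) (fun p : SiteY x.toKIdx × ι => blkC x.toKIdx ιB p.1)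
      (conj b (D (Sum.inr μ)) * (conj b (D (Sum.inl ν)) * conj b Gu)) (fun p q => (gX * Bin) * 1 * Real.exp (-(ρ₁ * (geo9Y x).dist p q))) := fun μ ν => by
    have hin : HasL2Majorant (g := toB6 (geo9Y x) (0 : ℝ) True) (fun p : SiteY x.toKIdx × ι => blkC x.toKIdx ιB p.1)
        (conj b (D (Sum.inl μ)) * (conj b (D (Sum.inl ν)) * conj b Gu)) (fun p q => Bin * 1 * Real.exp (-(δ₀ * (geo9Y x).dist p q))) := by
      rw [← mul_assoc]; exact r3 μ ν
    have h := hasL2Majorant_cross_left b (shiftY x.toKIdx) (UboxY x.toKIdx U) (Rr := (0 : ℝ)) (H := True) (g := geo9Y x) (fun z => blkC x.toKIdx ιB z) dL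
      (((η : ℂ))⁻¹) 1 d₀ M₂ δ₀ δ₀ (1 / 12) (1 / 12) ρ₁ Λ Bin (fun _ => (1 : ℝ)) (fun _ => zero_le_one) hδ₀.le hM₂ hBin0 hΛ0 hρ₁0 hr₁ hρ₁δ hrepr hdnn htri
      h261 hT0 hρu hd₀B μ (Gp := conj b (D (Sum.inl ν)) * conj b Gu) hin
    exact hasL2Majorant_mono (g := toB6 (geo9Y x) (0 : ℝ) True) _ h fun p q =>
      mul_le_mul_of_nonneg_right (mul_le_mul_of_nonneg_right (hstep δ₀ Bin le_rfl hBin0) zero_le_one) (Real.exp_nonneg _)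
  have w3_rr : ∀ μ ν, HasL2Majorant (g := toB6 (geo9Y x) (0 : ℝ) True) (fun p : SiteY x.toKIdx × ι => blkC x.toKIdx ιB p.1)
      (conj b (D (Sum.inr μ)) * (conj b (D (Sum.inr ν)) * conj b Gu)) (fun p q => (gX * (gI * Bin)) * 1 * Real.exp (-(ρ₂ * (geo9Y x).dist p q))) :=
    fun μ ν => by
    have hin : HasL2Majorant (g := toB6 (geo9Y x) (0 : ℝ) True) (fun p : SiteY x.toKIdx × ι => blkC x.toKIdx ιB p.1)
        (conj b (D (Sum.inl μ)) * (conj b (D (Sum.inr ν)) * conj b Gu)) (fun p q => (gI * Bin) * 1 * Real.exp (-(ρ₁ * (geo9Y x).dist p q))) := by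
      rw [← mul_assoc]; exact w3_li μ ν
    have h := hasL2Majorant_cross_left b (shiftY x.toKIdx) (UboxY x.toKIdx U) (Rr := (0 : ℝ)) (H := True) (g := geo9Y x) (fun z => blkC x.toKIdx ιB z) dL
      (((η : ℂ))⁻¹) 1 d₀ M₂ δ₀ ρ₁ (1 / 12) (1 / 12) ρ₂ Λ (gI * Bin) (fun _ => (1 : ℝ)) (fun _ => zero_le_one) hρ₁0 hM₂ (mul_nonneg hgI0 hBin0) hΛ0 hρ₂0 hr₂
      hρ₂₁ hrepr hdnn htri h261 hT0 hρu hd₀B μ (Gp := conj b (D (Sum.inr ν)) * conj b Gu) hin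
    exact hasL2Majorant_mono (g := toB6 (geo9Y x) (0 : ℝ) True) _ h fun p q =>
      mul_le_mul_of_nonneg_right (mul_le_mul_of_nonneg_right (hstep ρ₁ (gI * Bin) hρ₁δ (mul_nonneg hgI0 hBin0)) zero_le_one) (Real.exp_nonneg _)
  -- WORD 5.  inner switch (inl μ, inr ν) at rate ρ₁
  have w5_li : ∀ μ ν, HasL2Majorant (g := toB6 (geo9Y x) (0 : ℝ) True) (fun p : SiteY x.toKIdx × ι => blkC x.toKIdx ιB p.1)
      (conj b Gu * conj b (D (Sum.inl μ)) * conj b (D (Sum.inr ν))) (fun p q => (gI * Bin) * 1 * Real.exp (-(ρ₁ * (geo9Y x).dist p q))) := fun μ ν => by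
    have h := hasL2Majorant_cross2_right_inner b (shiftY x.toKIdx) (UboxY x.toKIdx U) (Rr := (0 : ℝ)) (H := True) (g := geo9Y x)
      (fun z => blkC x.toKIdx ιB z) dL hη0 1 cP σ₁ d₀ M₂ δ₀ δ₀ (1 / 12) (1 / 12) ρ₁ Λ Λ Bin hcP hσ₁0 hM₂ hBin0 hΛ0 hΛ0 hρ₁0 hr₁ hrepr hdnn
      htri hlen h261 hT0 hTi2 μ ν (hcomm μ ν) hρu (hplaq' μ ν) hd₀FB (hσ ν) heta (Gp := conj b Gu) (r5 μ ν) (r2 μ)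
    exact hasL2Majorant_mono (g := toB6 (geo9Y x) (0 : ℝ) True) _ h fun p q =>
      mul_le_mul_of_nonneg_right (mul_le_mul_of_nonneg_right (hstepI ρ₁ Bin hρ₁δ hBin0) zero_le_one) (Real.exp_nonneg _)
  -- outer switch (inr μ, inl ν) at rate ρ₁ and (inl μ, inl ν) at rate ρ₂
  have w5_rl : ∀ μ ν, HasL2Majorant (g := toB6 (geo9Y x) (0 : ℝ) True) (fun p : SiteY x.toKIdx × ι => blkC x.toKIdx ιB p.1)
      (conj b Gu * conj b (D (Sum.inr μ)) * conj b (D (Sum.inl ν))) (fun p q => (gX * Bin) * 1 * Real.exp (-(ρ₁ * (geo9Y x).dist p q))) := fun μ ν => by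
    have h := hasL2Majorant_cross_right b (shiftY x.toKIdx) (UboxY x.toKIdx U) (Rr := (0 : ℝ)) (H := True) (g := geo9Y x) (fun z => blkC x.toKIdx ιB z) dL
      (((η : ℂ))⁻¹) 1 d₀ M₂ δ₀ δ₀ (1 / 12) (1 / 12) ρ₁ Λ Bin (fun _ => (1 : ℝ)) (fun _ => zero_le_one) hM₂ hBin0 hΛ hρ₁0 hr₁ hαδ hrepr hdnn htri h261
      hρu hd₀F ν (Gp := conj b Gu * conj b (D (Sum.inr μ))) (r5 μ ν)
    exact hasL2Majorant_mono (g := toB6 (geo9Y x) (0 : ℝ) True) _ h fun p q =>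
      mul_le_mul_of_nonneg_right (mul_le_mul_of_nonneg_right (hstep ρ₁ Bin hρ₁δ hBin0) zero_le_one) (Real.exp_nonneg _)
  have w5_ll : ∀ μ ν, HasL2Majorant (g := toB6 (geo9Y x) (0 : ℝ) True) (fun p : SiteY x.toKIdx × ι => blkC x.toKIdx ιB p.1)
      (conj b Gu * conj b (D (Sum.inl μ)) * conj b (D (Sum.inl ν))) (fun p q => (gX * (gI * Bin)) * 1 * Real.exp (-(ρ₂ * (geo9Y x).dist p q))) :=
    fun μ ν => by
    have h := hasL2Majorant_cross_right b (shiftY x.toKIdx) (UboxY x.toKIdx U) (Rr := (0 : ℝ)) (H := True) (g := geo9Y x) (fun z => blkC x.toKIdx ιB z) dL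
      (((η : ℂ))⁻¹) 1 d₀ M₂ δ₀ ρ₁ (1 / 12) (1 / 12) ρ₂ Λ (gI * Bin) (fun _ => (1 : ℝ)) (fun _ => zero_le_one) hM₂ (mul_nonneg hgI0 hBin0) hΛ hρ₂0 hr₂ hαδ
      hrepr hdnn htri h261 hρu hd₀F ν (Gp := conj b Gu * conj b (D (Sum.inl μ))) (w5_li μ ν)
    exact hasL2Majorant_mono (g := toB6 (geo9Y x) (0 : ℝ) True) _ h fun p q =>
      mul_le_mul_of_nonneg_right (mul_le_mul_of_nonneg_right (hstep ρ₂ (gI * Bin) (hρ₂₁.trans hρ₁δ) (mul_nonneg hgI0 hBin0)) zero_le_one)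
        (Real.exp_nonneg _)
  -- assemble: common constant `Bx = g_X·g_I·Bin`, common rate `δ₀/2`
  have hBx0 : 0 ≤ Bx := by rw [hBx]; positivity
  have hle1 : Bin ≤ Bx := by
    rw [hBx]
    calc Bin ≤ gI * Bin := le_mul_of_one_le_left hBin0 hgI1
      _ ≤ gX * (gI * Bin) := le_mul_of_one_le_left (mul_nonneg hgI0 hBin0) hgX1
      _ = gX * gI * Bin := by ring
  have hle2 : gX * Bin ≤ Bx := by
    rw [hBx, mul_assoc]; exact mul_le_mul_of_nonneg_left (le_mul_of_one_le_left hBin0 hgI1) hgX0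
  have hle3 : gI * Bin ≤ Bx := by rw [hBx, mul_assoc]; exact le_mul_of_one_le_left (mul_nonneg hgI0 hBin0) hgX1
  have hle4 : gX * (gI * Bin) ≤ Bx := by rw [hBx, mul_assoc]
  have mono : ∀ {Tm : Module.End ℝ (SiteY x.toKIdx × ι → ℝ)} {Bc r : ℝ} (n : Fin 6), 0 ≤ Bc → Bc ≤ Bx → δ₀ / 2 ≤ r →
      (∀ p : (geo9Y x).Site, (1 : ℝ) = B9.pref6 ((geo9Y x).len p) n) →
      HasL2Majorant (g := toB6 (geo9Y x) (0 : ℝ) True) (fun p : SiteY x.toKIdx × ι => blkC x.toKIdx ιB p.1) Tm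
        (fun p q => Bc * 1 * Real.exp (-(r * (geo9Y x).dist p q))) →
      HasL2Majorant (g := toB6 (geo9Y x) (0 : ℝ) True) (fun p : SiteY x.toKIdx × ι => blkC x.toKIdx ιB p.1) Tm
        (fun p q => Bx * B9.pref6 ((geo9Y x).len p) n * Real.exp (-(δ₀ / 2 * (geo9Y x).dist p q))) := by
    intro Tm Bc r n hBc hBcx hr hwn h
    have h' := hasL2Majorant_rate_mono (R := (0 : ℝ)) (H := True) (g := geo9Y x) _ Bc (fun _ => (1 : ℝ)) hBc (fun _ => zero_le_one) hr hdnn h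
    exact hasL2Majorant_mono (g := toB6 (geo9Y x) (0 : ℝ) True) _ h' fun p q => by
      rw [← hwn p]; exact mul_le_mul_of_nonneg_right (mul_le_mul_of_nonneg_right hBcx zero_le_one) (Real.exp_nonneg _)
  have h01 : δ₀ / 2 ≤ ρ₁ := by rw [hρ₁]; linarith
  have h02 : δ₀ / 2 ≤ ρ₂ := by rw [hρ₂]; linarith
  have h00 : δ₀ / 2 ≤ δ₀ := by linarith
  refine ⟨fun k l => ?_, fun k l => ?_⟩
  · -- word 3: `D k * D l * Gu`
    show HasL2Majorant (g := toB6 (geo9Y x) (0 : ℝ) True) (fun p : SiteY x.toKIdx × ι => blkC x.toKIdx ιB p.1) (conj b (D k * D l * Gu)) _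
    rw [B9Eq352DivFormLetters.conj_mul, B9Eq352DivFormLetters.conj_mul]
    cases k with
    | inl μ =>
      cases l with
      | inl ν => exact mono 3 hBin0 hle1 h00 (fun p => rfl) (r3 μ ν)
      | inr ν => exact mono 3 (mul_nonneg hgI0 hBin0) hle3 h01 (fun p => rfl) (w3_li μ ν)
    | inr μ =>
      cases l with
      | inl ν =>
        rw [mul_assoc]
        exact mono 3 (mul_nonneg hgX0 hBin0) hle2 h01 (fun p => rfl) (w3_rl μ ν)
      | inr ν =>
        rw [mul_assoc]
        exact mono 3 (mul_nonneg hgX0 (mul_nonneg hgI0 hBin0)) hle4 h02 (fun p => rfl) (w3_rr μ ν)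
  · -- word 5: `Gu * D k * D l`
    show HasL2Majorant (g := toB6 (geo9Y x) (0 : ℝ) True) (fun p : SiteY x.toKIdx × ι => blkC x.toKIdx ιB p.1) (conj b (Gu * D k * D l)) _
    rw [B9Eq352DivFormLetters.conj_mul, B9Eq352DivFormLetters.conj_mul]
    cases k with
    | inl μ =>
      cases l with
      | inl ν => exact mono 5 (mul_nonneg hgX0 (mul_nonneg hgI0 hBin0)) hle4 h02 (fun p => rfl) (w5_ll μ ν)
      | inr ν => exact mono 5 (mul_nonneg hgI0 hBin0) hle3 h01 (fun p => rfl) (w5_li μ ν)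
    | inr μ =>
      cases l with
      | inl ν => exact mono 5 (mul_nonneg hgX0 hBin0) hle2 h01 (fun p => rfl) (w5_rl μ ν)
      | inr ν => exact mono 5 hBin0 hle1 h00 (fun p => rfl) (r5 μ ν)

end Hin

/-! ## §2  ★★ hout: the record's (3.46) block at `U′U` from the augmented member's block, second differences included -/

section Hout

variable (G : Subgroup 𝔸ˣ) (x : MemberY d ℓ hd hL b₀ b₁ Mstar) (par : SiteParY 𝔸 x.toKIdx) {ι : Type} [Fintype ι] [DecidableEq ι]
  (b : Module.Basis ι ℝ 𝔸) (ιB : BlkY x.toKIdx → IBondY x.toKIdx) [Fintype (geo9Y x).Site] [DecidableEq (geo9Y x).Site]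
  (C37 C38 : ℝ → CfgY 𝔸 x.toKIdx → AfldY 𝔸 x.toKIdx → Prop)

/-- ★ **THE CONSTANT OF THE `L²` CONVERSION WITH SECOND DIFFERENCES** (member-independent): the maximum of `B9SectBL2TransferConvY.convConstL2` (members
`0, 1, 2` and the mixed one) and the two second-order constants `K_L·B_in`, `K_R·B_in` of `B9Eq370SecondOrderConversionL2` at the record's data
(`α₁ ↦ 1/4`, `d₀ = 2(d+1)`, rates `δ₀ ↦ 5δ₀/6 ↦ 2δ₀/3`, one transfer constant `Λ`, `σ₂ = Λe^{δ₀d₀/6}`, `B_in = sι·M₂·Sb·B₀`).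
[cite: Balaban1985BackgroundPropagators, p.403 l.1–9 («of course with different constants»), bookkeeping] -/
def convConst2L2 (cP M₂ Sb sι : ℝ) (d dL : ℕ) (δ₀ Λ B₀ : ℝ) : ℝ :=
  max (convConstL2 M₂ Sb sι d dL δ₀ Λ B₀)
    (max (conv2ConstL cP M₂ Sb sι (2 * ((d : ℝ) + 1)) δ₀ (5 * δ₀ / 6) (1 / 4) Λ Λ (B6.c1 dL δ₀ (1 / 12)) * ((sι * M₂ * Sb) * B₀))
      (conv2ConstR cP (Λ * Real.exp (1 / 12 * δ₀ * (2 * (2 * ((d : ℝ) + 1))))) M₂ Sb sι (2 * ((d : ℝ) + 1)) (5 * δ₀ / 6) (2 * δ₀ / 3) (1 / 4) Λ Λ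
          (B6.c1 dL δ₀ (1 / 12)) * ((sι * M₂ * Sb) * B₀)))

/-- ★★ **THE TWO SECOND-ORDER `W`-FAMILIES AT ONE MEMBER** (the displayed hypotheses `hLL`, `hRR` of `B9SectBL2TransferConvY.l2Block_record_at_W_of_KSC₃`,
DISCHARGED modulo the plaquette law): for `(U, a)` in the coded class at `α₁ ≦ 1/4`, from `L2Block (KSC₃ …) B₀ δ₀ (.prod U a)` (letters at `U`, operator
`G′(W)`, `W = U′U`), the plaquette law `PlaqLawY c_P U`, Lemma 2.1 of [4] at `(δ₀, 1/12)` and the transfers of `ℓ, ℓ², ℓ⁻¹, ℓ⁻²`: block-`ℓ²` majorants at rate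
`2δ₀/3` of print's `∇_{W,μ}∇_{W,ν}·G_W` (constant `K_L·B_in`) and `G_W·∇*_{W,μ}∇*_{W,ν}` (constant `K_R·B_in`), `G_W = η²G′(W)`, `B_in = sι·M₂·Sb·B₀`.
[cite: Balaban1985BackgroundPropagators, p.403 l.1–9, (3.70) p.404, (3.74) p.405, (3.46) p.398, (3.37) p.396, p.404 (after (3.69)); Balaban1984PropagatorsII, Prop. 2.6 (2.140)–(2.141) p.247] -/
theorem secondWords_at_W (hι : ∀ s : BlkY x.toKIdx, β x.toKIdx.hN x.toKIdx.D x.toKIdx.hk (ιB s) = s)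
    (hG1 : ∀ u : 𝔸ˣ, u ∈ G → ‖(u : 𝔸)‖ ≤ 1) {M₂ : ℝ} (hM₂ : 0 ≤ M₂) (hrepr : ∀ (v : 𝔸) (j : ι), |b.repr v j| ≤ M₂ * ‖v‖)
    {Cq : ℝ} (hC37 : ∀ β' U a, C37 β' U a → GVal G x.toKIdx U ∧ CplxLettersY G x par ιB Cq β' U a)
    {δ₀ : ℝ} (hδ₀ : 0 < δ₀) {dL : ℕ} (h261 : Ineq261 dL (toB6 (geo9Y x) (0 : ℝ) True) δ₀ (1 / 12)) {Λ : ℝ} (hΛ : 0 ≤ Λ)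
    (hT1 : ScaleTransfer (geo9Y x) δ₀ (1 / 12) Λ (fun a => (geo9Y x).len a))
    (hT2 : ScaleTransfer (geo9Y x) δ₀ (1 / 12) Λ (fun a => (geo9Y x).len a ^ 2))
    (hTi : ScaleTransfer (geo9Y x) δ₀ (1 / 12) Λ (fun a => ((geo9Y x).len a)⁻¹))
    (hTi2 : ScaleTransfer (geo9Y x) δ₀ (1 / 12) Λ (fun a => ((geo9Y x).len a)⁻¹ ^ 2))
    {cP : ℝ} (hcP : 0 ≤ cP) {B₀ : ℝ} (hB₀ : 0 ≤ B₀) {U : CfgY 𝔸 x.toKIdx} {a : AfldY 𝔸 x.toKIdx} {α₁ : ℝ} (hα₁c : α₁ ≤ 1 / 4) (hC : C37 α₁ U a)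
    (hplaq : PlaqLawY x ιB cP U) (hL2 : L2Block (KSC₃ G x par C37 C38) B₀ δ₀ (.prod U a)) :
    (∀ μ ν : Fin (d + 1), HasL2Majorant (g := toB6 (geo9Y x) (0 : ℝ) True) (fun p : SiteY x.toKIdx × ι => blkC x.toKIdx ιB p.1)
      (conj b (diffLetter (shiftY x.toKIdx) (UboxY x.toKIdx (mulY x.toKIdx (fluct (kGeo x.toKIdx).eta a) U)) ((((kGeo x.toKIdx).eta : ℂ))⁻¹) (Sum.inl μ)) *
        conj b (diffLetter (shiftY x.toKIdx) (UboxY x.toKIdx (mulY x.toKIdx (fluct (kGeo x.toKIdx).eta a) U)) ((((kGeo x.toKIdx).eta : ℂ))⁻¹) (Sum.inl ν)) *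
        conj b (((kGeo x.toKIdx).eta ^ 2) • (GpY x.toKIdx par (mulY x.toKIdx (fluct (kGeo x.toKIdx).eta a) U)).restrictScalars ℝ))
      (fun p q => (conv2ConstL cP M₂ (∑ j, ‖b j‖) (Real.sqrt (Fintype.card ι)) (2 * ((d : ℝ) + 1)) δ₀ (5 * δ₀ / 6) (1 / 4) Λ Λ (B6.c1 dL δ₀ (1 / 12))
          * ((Real.sqrt (Fintype.card ι) * M₂ * ∑ j, ‖b j‖) * B₀)) * 1 * Real.exp (-(2 * δ₀ / 3 * (geo9Y x).dist p q)))) ∧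
    (∀ μ ν : Fin (d + 1), HasL2Majorant (g := toB6 (geo9Y x) (0 : ℝ) True) (fun p : SiteY x.toKIdx × ι => blkC x.toKIdx ιB p.1)
      (conj b (((kGeo x.toKIdx).eta ^ 2) • (GpY x.toKIdx par (mulY x.toKIdx (fluct (kGeo x.toKIdx).eta a) U)).restrictScalars ℝ) *
        conj b (diffLetter (shiftY x.toKIdx) (UboxY x.toKIdx (mulY x.toKIdx (fluct (kGeo x.toKIdx).eta a) U)) ((((kGeo x.toKIdx).eta : ℂ))⁻¹) (Sum.inr μ)) *
        conj b (diffLetter (shiftY x.toKIdx) (UboxY x.toKIdx (mulY x.toKIdx (fluct (kGeo x.toKIdx).eta a) U)) ((((kGeo x.toKIdx).eta : ℂ))⁻¹) (Sum.inr ν)))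
      (fun p q => (conv2ConstR cP (Λ * Real.exp (1 / 12 * δ₀ * (2 * (2 * ((d : ℝ) + 1))))) M₂ (∑ j, ‖b j‖) (Real.sqrt (Fintype.card ι))
          (2 * ((d : ℝ) + 1)) (5 * δ₀ / 6) (2 * δ₀ / 3) (1 / 4) Λ Λ (B6.c1 dL δ₀ (1 / 12)) * ((Real.sqrt (Fintype.card ι) * M₂ * ∑ j, ‖b j‖) * B₀)) * 1 *
        Real.exp (-(2 * δ₀ / 3 * (geo9Y x).dist p q)))) := by
  -- constants
  set η : ℝ := (kGeo x.toKIdx).eta with hηdef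
  have hη0 : 0 < η := geo9K_eta_pos x.toKIdx
  set W : CfgY 𝔸 x.toKIdx := mulY x.toKIdx (fluct η a) U with hW
  set Bin : ℝ := (Real.sqrt (Fintype.card ι) * M₂ * ∑ j, ‖b j‖) * B₀ with hBin
  set d₀ : ℝ := 2 * ((d : ℝ) + 1) with hd₀
  set ρ₁ : ℝ := 5 * δ₀ / 6 with hρ₁
  set ρ₂ : ℝ := 2 * δ₀ / 3 with hρ₂
  set σ₂ : ℝ := Λ * Real.exp (1 / 12 * δ₀ * (2 * d₀)) with hσ₂
  have hSb : 0 ≤ ∑ j, ‖b j‖ := Finset.sum_nonneg fun j _ => norm_nonneg _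
  have hBin0 : 0 ≤ Bin := by positivity
  have hσ₂0 : 0 ≤ σ₂ := by positivity
  -- geometry of the member
  have hdnn : ∀ y y' : (geo9Y x).Site, 0 ≤ (geo9Y x).dist y y' := geo9Y_dist_nonneg x
  have htri : Triangle254 (toB6 (geo9Y x) (0 : ℝ) True) := fun p q r => geo9Y_dist_triangle x p q r
  have htri' : ∀ p q r : (geo9Y x).Site, (geo9Y x).dist p r ≤ (geo9Y x).dist p q + (geo9Y x).dist q r := fun p q r => geo9Y_dist_triangle x p q r
  have hlen : ∀ y : (geo9Y x).Site, 0 < (geo9Y x).len y := geo9Y_len_pos x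
  have hd₀FB : ∀ (μ : Fin (d + 1)) (z : SiteY x.toKIdx), (geo9Y x).dist (blkC x.toKIdx ιB z) (blkC x.toKIdx ιB (shiftY x.toKIdx μ z)) ≤ d₀ ∧
      (geo9Y x).dist (blkC x.toKIdx ιB z) (blkC x.toKIdx ιB ((shiftY x.toKIdx μ).symm z)) ≤ d₀ :=
    fun μ z => ⟨stencilF_blkC x.toKIdx ιB hι μ z, stencilB_blkC x.toKIdx ιB hι μ z⟩
  have heta : ∀ y : (geo9Y x).Site, η ≤ (geo9Y x).len y := eta_le_len x
  have hcomm : ∀ (μ ν : Fin (d + 1)) (z : SiteY x.toKIdx), shiftY x.toKIdx μ (shiftY x.toKIdx ν z) = shiftY x.toKIdx ν (shiftY x.toKIdx μ z) :=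
    shiftY_comm x
  have hαδ : 0 ≤ 1 / 12 * δ₀ := by positivity
  have hσ : ∀ (μ ν : Fin (d + 1)) (z : SiteY x.toKIdx),
      ((geo9Y x).len (blkC x.toKIdx ιB ((shiftY x.toKIdx ν).symm ((shiftY x.toKIdx μ).symm z))))⁻¹ ^ 2 ≤ σ₂ * ((geo9Y x).len (blkC x.toKIdx ιB z))⁻¹ ^ 2 := by
    intro μ ν z
    have hd2 : (geo9Y x).dist (blkC x.toKIdx ιB z) (blkC x.toKIdx ιB ((shiftY x.toKIdx ν).symm ((shiftY x.toKIdx μ).symm z))) ≤ 2 * d₀ := by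
      have h1 := (hd₀FB μ z).2
      have h2 := (hd₀FB ν ((shiftY x.toKIdx μ).symm z)).2
      have h3 := htri' (blkC x.toKIdx ιB z) (blkC x.toKIdx ιB ((shiftY x.toKIdx μ).symm z))
        (blkC x.toKIdx ιB ((shiftY x.toKIdx ν).symm ((shiftY x.toKIdx μ).symm z)))
      linarith
    exact le_of_scaleTransfer (w := fun a => ((geo9Y x).len a)⁻¹ ^ 2) hTi2 hαδ hd2 (pow_nonneg (inv_nonneg.mpr (hlen _).le) _)
  -- the class: `U` is `G`-valued, the (3.37) letters at `α₁ ≤ 1/4`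
  obtain ⟨hU, hcl⟩ := hC37 α₁ U a hC
  obtain ⟨hA, -⟩ := letters337_of_cplxLettersY G x par ιB hα₁c hU hcl
  have hA2 := letters337b_of_cplxLettersY G x par ιB hα₁c hU hcl
  have hρu : ∀ (μ : Fin (d + 1)) (z : SiteY x.toKIdx), ‖((UboxY x.toKIdx U μ z : 𝔸ˣ) : 𝔸)‖ ≤ 1 ∧ ‖(((UboxY x.toKIdx U μ z)⁻¹ : 𝔸ˣ) : 𝔸)‖ ≤ 1 :=
    fun μ z => norm_le_one_and_inv_of_mem G hG1 (hU μ _ : UboxY x.toKIdx U μ z ∈ G)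
  have hsmall : ∀ y : (geo9Y x).Site, η * ((1 / 4 : ℝ) * ((geo9Y x).len y)⁻¹) ≤ 1 / 4 := by
    intro y
    have hl := hlen y
    rw [show η * ((1 / 4 : ℝ) * ((geo9Y x).len y)⁻¹) = (1 / 4) * (η / (geo9Y x).len y) by ring]
    have : η / (geo9Y x).len y ≤ 1 := (div_le_one hl).mpr (heta y)
    linarith
  have hplaq' : ∀ (μ ν : Fin (d + 1)) (z : SiteY x.toKIdx) (X : 𝔸),
      ‖R (UboxY x.toKIdx U μ z * UboxY x.toKIdx U ν (shiftY x.toKIdx μ z)) X - R (UboxY x.toKIdx U ν z * UboxY x.toKIdx U μ (shiftY x.toKIdx ν z)) X‖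
        ≤ cP * (η * ((geo9Y x).len (blkC x.toKIdx ιB z))⁻¹) ^ 2 * ‖X‖ := fun μ ν z X => hplaq μ ν z X
  -- the letters
  set Gw : Module.End ℝ (SiteY x.toKIdx → 𝔸) := (η ^ 2) • (GpY x.toKIdx par W).restrictScalars ℝ with hGw
  set DU : Fin (d + 1) ⊕ Fin (d + 1) → Module.End ℝ (SiteY x.toKIdx → 𝔸) := fun k => diffLetter (shiftY x.toKIdx) (UboxY x.toKIdx U) (((η : ℂ))⁻¹) k
    with hDU
  have hUW : UboxY x.toKIdx W = prodCfg (UboxY x.toKIdx U) η (chartA x.toKIdx a) := by rw [UboxY_mulY_fluct]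
  -- READ: the words of `KSC₃` at the product, letters at `U`, rate δ₀, constant `Bin`
  have hRd := fun n k l => hasL2Majorant_wordL_of_l2AugS x ιB b hι hM₂ hrepr (0 : ℝ) True (B := (codingYx G x C37 C38).bg) (fun c => c)
    (GpY x.toKIdx par) hB₀ (c := .prod U a) n (fun lam hh y y' hc hs => hL2 n lam hh y y' hc hs) k l
  have hK : ∀ (n : Fin 6) (p q : (geo9Y x).Site), (Real.sqrt (Fintype.card ι) * M₂ * ∑ j, ‖b j‖) * B₀ * B9.pref6 ((geo9Y x).len p) n *
      Real.exp (-(δ₀ * (geo9Y x).dist p q)) = Bin * B9.pref6 ((geo9Y x).len p) n * Real.exp (-(δ₀ * (geo9Y x).dist p q)) := fun n p q => by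
    rw [hBin]
  have g0 : HasL2Majorant (g := toB6 (geo9Y x) (0 : ℝ) True) (fun p : SiteY x.toKIdx × ι => blkC x.toKIdx ιB p.1) (conj b Gw)
      (fun p q => Bin * (geo9Y x).len p ^ 2 * Real.exp (-(δ₀ * (geo9Y x).dist p q))) :=
    hasL2Majorant_mono (g := toB6 (geo9Y x) (0 : ℝ) True) _ (hRd 0 (Sum.inl 0) (Sum.inl 0)) fun p q => le_of_eq (by rw [hK]; rfl)
  have g1 : ∀ k, HasL2Majorant (g := toB6 (geo9Y x) (0 : ℝ) True) (fun p : SiteY x.toKIdx × ι => blkC x.toKIdx ιB p.1) (conj b (DU k) * conj b Gw)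
      (fun p q => Bin * (geo9Y x).len p * Real.exp (-(δ₀ * (geo9Y x).dist p q))) := fun k => by
    have h : HasL2Majorant (g := toB6 (geo9Y x) (0 : ℝ) True) (fun p : SiteY x.toKIdx × ι => blkC x.toKIdx ιB p.1) (conj b (DU k * Gw))
        (fun p q => (Real.sqrt (Fintype.card ι) * M₂ * ∑ j, ‖b j‖) * B₀ * B9.pref6 ((geo9Y x).len p) 1 * Real.exp (-(δ₀ * (geo9Y x).dist p q))) :=
      hRd 1 k k
    rw [B9Eq352DivFormLetters.conj_mul] at h
    exact hasL2Majorant_mono (g := toB6 (geo9Y x) (0 : ℝ) True) _ h fun p q => le_of_eq (by rw [hK]; rfl)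
  have g2 : ∀ k, HasL2Majorant (g := toB6 (geo9Y x) (0 : ℝ) True) (fun p : SiteY x.toKIdx × ι => blkC x.toKIdx ιB p.1) (conj b Gw * conj b (DU k))
      (fun p q => Bin * (geo9Y x).len p * Real.exp (-(δ₀ * (geo9Y x).dist p q))) := fun k => by
    have h : HasL2Majorant (g := toB6 (geo9Y x) (0 : ℝ) True) (fun p : SiteY x.toKIdx × ι => blkC x.toKIdx ιB p.1) (conj b (Gw * DU k))
        (fun p q => (Real.sqrt (Fintype.card ι) * M₂ * ∑ j, ‖b j‖) * B₀ * B9.pref6 ((geo9Y x).len p) 2 * Real.exp (-(δ₀ * (geo9Y x).dist p q))) :=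
      hRd 2 k k
    rw [B9Eq352DivFormLetters.conj_mul] at h
    exact hasL2Majorant_mono (g := toB6 (geo9Y x) (0 : ℝ) True) _ h fun p q => le_of_eq (by rw [hK]; rfl)
  have g3 : ∀ k l, HasL2Majorant (g := toB6 (geo9Y x) (0 : ℝ) True) (fun p : SiteY x.toKIdx × ι => blkC x.toKIdx ιB p.1)
      (conj b (DU k) * conj b (DU l) * conj b Gw) (fun p q => Bin * 1 * Real.exp (-(δ₀ * (geo9Y x).dist p q))) := fun k l => by
    have h : HasL2Majorant (g := toB6 (geo9Y x) (0 : ℝ) True) (fun p : SiteY x.toKIdx × ι => blkC x.toKIdx ιB p.1) (conj b (DU k * DU l * Gw))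
        (fun p q => (Real.sqrt (Fintype.card ι) * M₂ * ∑ j, ‖b j‖) * B₀ * B9.pref6 ((geo9Y x).len p) 3 * Real.exp (-(δ₀ * (geo9Y x).dist p q))) :=
      hRd 3 k l
    rw [B9Eq352DivFormLetters.conj_mul, B9Eq352DivFormLetters.conj_mul] at h
    exact hasL2Majorant_mono (g := toB6 (geo9Y x) (0 : ℝ) True) _ h fun p q => le_of_eq (by rw [hK]; rfl)
  have g5 : ∀ k l, HasL2Majorant (g := toB6 (geo9Y x) (0 : ℝ) True) (fun p : SiteY x.toKIdx × ι => blkC x.toKIdx ιB p.1)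
      (conj b Gw * conj b (DU k) * conj b (DU l)) (fun p q => Bin * 1 * Real.exp (-(δ₀ * (geo9Y x).dist p q))) := fun k l => by
    have h : HasL2Majorant (g := toB6 (geo9Y x) (0 : ℝ) True) (fun p : SiteY x.toKIdx × ι => blkC x.toKIdx ιB p.1) (conj b (Gw * DU k * DU l))
        (fun p q => (Real.sqrt (Fintype.card ι) * M₂ * ∑ j, ‖b j‖) * B₀ * B9.pref6 ((geo9Y x).len p) 5 * Real.exp (-(δ₀ * (geo9Y x).dist p q))) :=
      hRd 5 k l
    rw [B9Eq352DivFormLetters.conj_mul, B9Eq352DivFormLetters.conj_mul] at h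
    exact hasL2Majorant_mono (g := toB6 (geo9Y x) (0 : ℝ) True) _ h fun p q => le_of_eq (by rw [hK]; rfl)
  -- rates
  have hρ₁0 : 0 ≤ ρ₁ := by rw [hρ₁]; positivity
  have hρ₂0 : 0 ≤ ρ₂ := by rw [hρ₂]; positivity
  have hr₁ : ρ₁ + (1 / 12 + 1 / 12) * δ₀ ≤ δ₀ := by rw [hρ₁]; linarith
  have hρ₁δ : ρ₁ ≤ δ₀ := by rw [hρ₁]; linarith
  have hr₂ : ρ₂ + (1 / 12 + 1 / 12) * δ₀ ≤ ρ₁ := by rw [hρ₁, hρ₂]; linarith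
  have hρ₂₁ : ρ₂ ≤ ρ₁ := by rw [hρ₁, hρ₂]; linarith
  refine ⟨fun μ ν => ?_, fun μ ν => ?_⟩
  · -- LEFT: `∇_{W,μ}∇_{W,ν}·Gw`
    rw [hUW]
    exact hasL2Majorant_diffLetter2_prodCfg_mul b (shiftY x.toKIdx) (UboxY x.toKIdx U) (Rr := (0 : ℝ)) (H := True) (g := geo9Y x)
      (fun z => blkC x.toKIdx ιB z) dL hη0 (chartA x.toKIdx a) d₀ M₂ (1 / 4) cP δ₀ δ₀ (1 / 12) (1 / 12) ρ₁ ρ₂ Λ Λ Bin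
      (by norm_num) hcP hM₂ hBin0 hΛ hΛ hρ₂0 hρ₁0 hr₁ hr₂ hρ₁δ hρ₂₁ hrepr hdnn htri hlen h261 hT1 hT2 hsmall hA hA2 hρu hd₀FB hcomm hplaq' heta μ ν
      (Gp := conj b Gw) g0 (g1 (Sum.inl μ)) (g1 (Sum.inl ν)) (g3 (Sum.inl μ) (Sum.inl ν))
  · -- RIGHT: `Gw·∇*_{W,μ}∇*_{W,ν}`
    rw [hUW]
    exact hasL2Majorant_mul_diffLetter2_prodCfg b (shiftY x.toKIdx) (UboxY x.toKIdx U) (Rr := (0 : ℝ)) (H := True) (g := geo9Y x)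
      (fun z => blkC x.toKIdx ιB z) dL hη0 (chartA x.toKIdx a) d₀ M₂ (1 / 4) cP σ₂ δ₀ δ₀ (1 / 12) (1 / 12) ρ₁ ρ₂ Λ Λ Bin
      (by norm_num) hcP hσ₂0 hM₂ hBin0 hΛ hΛ hρ₂0 hρ₁0 hr₁ hr₂ hρ₁δ hρ₂₁ hrepr hdnn htri hlen h261 hTi hTi2 hsmall hA hA2 hρu hd₀FB hcomm hplaq' hσ heta μ ν
      (Gp := conj b Gw) g0 (g2 (Sum.inr μ)) (g2 (Sum.inr ν)) (g5 (Sum.inr μ) (Sum.inr ν))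

omit [NormedRing 𝔸] [NormedAlgebra ℂ 𝔸] [CompleteSpace 𝔸] [NormOneClass 𝔸] [FiniteDimensional ℝ 𝔸] in
/-- `convConst2L2 ≧ 0`. [cite: Balaban1985BackgroundPropagators, p.403 l.1–9, bookkeeping] -/
theorem convConst2L2_nonneg {cP M₂ Sb sι : ℝ} (hcP : 0 ≤ cP) (hM₂ : 0 ≤ M₂) (hSb : 0 ≤ Sb) (hsι : 0 ≤ sι) (d dL : ℕ) {δ₀ Λ B₀ : ℝ}
    (hΛ : 0 ≤ Λ) (hB₀ : 0 ≤ B₀) :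
    0 ≤ convConstL2 M₂ Sb sι d dL δ₀ Λ B₀ ∧
      0 ≤ conv2ConstL cP M₂ Sb sι (2 * ((d : ℝ) + 1)) δ₀ (5 * δ₀ / 6) (1 / 4) Λ Λ (B6.c1 dL δ₀ (1 / 12)) * ((sι * M₂ * Sb) * B₀) ∧
      0 ≤ conv2ConstR cP (Λ * Real.exp (1 / 12 * δ₀ * (2 * (2 * ((d : ℝ) + 1))))) M₂ Sb sι (2 * ((d : ℝ) + 1)) (5 * δ₀ / 6) (2 * δ₀ / 3) (1 / 4) Λ Λ
          (B6.c1 dL δ₀ (1 / 12)) * ((sι * M₂ * Sb) * B₀) ∧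
      0 ≤ convConst2L2 cP M₂ Sb sι d dL δ₀ Λ B₀ := by
  have hc1 := B6RandomWalk.c1_nonneg dL δ₀ (1 / 12)
  have h1 := cDef_nonneg hM₂ hSb hsι d δ₀
  have h2 := cDef_nonneg hM₂ hSb hsι d (5 * δ₀ / 6)
  have e1 := B9Eq370SecondOrderConversionL2.cE_nonneg hM₂ hSb hsι (5 * δ₀ / 6) (2 * ((d : ℝ) + 1))
  have e2 := B9Eq370SecondOrderConversionL2.cE_nonneg hM₂ hSb hsι δ₀ (2 * ((d : ℝ) + 1))
  have e3 := B9Eq370SecondOrderConversionL2.cE_nonneg hM₂ hSb hsι (2 * δ₀ / 3) (2 * ((d : ℝ) + 1))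
  have q1 := B9Eq370SecondOrderConversionL2.cQ_nonneg hcP hM₂ hSb hsι (5 * δ₀ / 6) (2 * ((d : ℝ) + 1))
  have q2 := B9Eq370SecondOrderConversionL2.cQ_nonneg hcP hM₂ hSb hsι (2 * δ₀ / 3) (2 * ((d : ℝ) + 1))
  have hA : 0 ≤ convConstL2 M₂ Sb sι d dL δ₀ Λ B₀ := by unfold convConstL2; positivity
  have hB : 0 ≤ conv2ConstL cP M₂ Sb sι (2 * ((d : ℝ) + 1)) δ₀ (5 * δ₀ / 6) (1 / 4) Λ Λ (B6.c1 dL δ₀ (1 / 12)) * ((sι * M₂ * Sb) * B₀) := by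
    unfold conv2ConstL; positivity
  have hC : 0 ≤ conv2ConstR cP (Λ * Real.exp (1 / 12 * δ₀ * (2 * (2 * ((d : ℝ) + 1))))) M₂ Sb sι (2 * ((d : ℝ) + 1)) (5 * δ₀ / 6) (2 * δ₀ / 3)
      (1 / 4) Λ Λ (B6.c1 dL δ₀ (1 / 12)) * ((sι * M₂ * Sb) * B₀) := by
    unfold conv2ConstR; positivity
  exact ⟨hA, hB, hC, le_max_of_le_left hA⟩

/-- ★★ **THE RECORD's (3.46) BLOCK AT `W = U′U`, ALL SIX MEMBERS, FROM THE AUGMENTED MEMBER's BLOCK AT THE PRODUCT** — the hout side of the `L²` member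
with the second differences supplied by `secondWords_at_W` (no displayed second-difference hypotheses; the plaquette law `PlaqLawY c_P U` of the base
instead): for `(U, a)` in the coded class at `α₁ ≦ 1/4`, `L2Block (KSC₃ …) B₀ δ₀ (.prod U a)`, Lemma 2.1 of [4] at `(δ₀, 1/12)` and the scale transfers of
`ℓ, ℓ², ℓ⁻¹, ℓ⁻²` give `L2Block (kernelFamilyS … id (GpY par) par) (c_L·convConst2L2) (δ₀/2) (U′U)` — members `0, 1, 2` and the mixed one by
`hconvL2_words_at`, `∇_{U′U}∇_{U′U}G′` and `G′∇*_{U′U}∇*_{U′U}` by `secondWords_at_W`, written by `l2Block_kernelFamilyS_of_printWords`.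
[cite: Balaban1985BackgroundPropagators, p.403 l.1–9, (3.70) p.404, (3.74) p.405, Thm 3.1 (3.46) p.398, Thm 3.4 p.400; Balaban1984PropagatorsII, Prop. 2.6 (2.140)–(2.141) p.247, Lemma 2.1 p.234] -/
theorem l2Block_record_at_W_of_KSC₃' (hι : ∀ s : BlkY x.toKIdx, β x.toKIdx.hN x.toKIdx.D x.toKIdx.hk (ιB s) = s)
    (hG1 : ∀ u : 𝔸ˣ, u ∈ G → ‖(u : 𝔸)‖ ≤ 1) {M₂ : ℝ} (hM₂ : 0 ≤ M₂) (hrepr : ∀ (v : 𝔸) (j : ι), |b.repr v j| ≤ M₂ * ‖v‖)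
    {Cq : ℝ} (hC37 : ∀ β' U a, C37 β' U a → GVal G x.toKIdx U ∧ CplxLettersY G x par ιB Cq β' U a)
    {δ₀ : ℝ} (hδ₀ : 0 < δ₀) {dL : ℕ} (h261 : Ineq261 dL (toB6 (geo9Y x) (0 : ℝ) True) δ₀ (1 / 12)) {Λ : ℝ} (hΛ : 0 ≤ Λ)
    (hT1 : ScaleTransfer (geo9Y x) δ₀ (1 / 12) Λ (fun a => (geo9Y x).len a))
    (hT2 : ScaleTransfer (geo9Y x) δ₀ (1 / 12) Λ (fun a => (geo9Y x).len a ^ 2))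
    (hTi : ScaleTransfer (geo9Y x) δ₀ (1 / 12) Λ (fun a => ((geo9Y x).len a)⁻¹))
    (hTi2 : ScaleTransfer (geo9Y x) δ₀ (1 / 12) Λ (fun a => ((geo9Y x).len a)⁻¹ ^ 2))
    {cP : ℝ} (hcP : 0 ≤ cP) {B₀ : ℝ} (hB₀ : 0 ≤ B₀) {U : CfgY 𝔸 x.toKIdx} {a : AfldY 𝔸 x.toKIdx} {α₁ : ℝ} (hα₁c : α₁ ≤ 1 / 4) (hC : C37 α₁ U a)
    (hplaq : PlaqLawY x ιB cP U) (hL2 : L2Block (KSC₃ G x par C37 C38) B₀ δ₀ (.prod U a)) :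
    L2Block (kernelFamilyS x.toKIdx (bg9Y 𝔸 G x) (fun U => U) (GpY x.toKIdx par) par)
      ((Real.sqrt (Fintype.card ι) * M₂ * ∑ j, ‖b j‖) * convConst2L2 cP M₂ (∑ j, ‖b j‖) (Real.sqrt (Fintype.card ι)) d dL δ₀ Λ B₀) (δ₀ / 2)
      (mulY x.toKIdx (fluct (kGeo x.toKIdx).eta a) U) := by
  obtain ⟨h0, h1, h2, h4⟩ := hconvL2_words_at G x par b ιB C37 C38 hι hG1 hM₂ hrepr hC37 hδ₀ h261 hΛ hT1 hT2 hTi hB₀ hα₁c hC hL2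
  obtain ⟨hLL, hRR⟩ := secondWords_at_W G x par b ιB C37 C38 hι hG1 hM₂ hrepr hC37 hδ₀ h261 hΛ hT1 hT2 hTi hTi2 hcP hB₀ hα₁c hC hplaq hL2
  have hSb : 0 ≤ ∑ j, ‖b j‖ := Finset.sum_nonneg fun j _ => norm_nonneg _
  obtain ⟨hBc0, hBL0, hBR0, hBx0⟩ := convConst2L2_nonneg (dL := dL) (δ₀ := δ₀) hcP hM₂ hSb (Real.sqrt_nonneg (Fintype.card ι)) d hΛ hB₀
  have hBx : convConst2L2 cP M₂ (∑ j, ‖b j‖) (Real.sqrt (Fintype.card ι)) d dL δ₀ Λ B₀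
      = max (convConstL2 M₂ (∑ j, ‖b j‖) (Real.sqrt (Fintype.card ι)) d dL δ₀ Λ B₀)
        (max (conv2ConstL cP M₂ (∑ j, ‖b j‖) (Real.sqrt (Fintype.card ι)) (2 * ((d : ℝ) + 1)) δ₀ (5 * δ₀ / 6) (1 / 4) Λ Λ (B6.c1 dL δ₀ (1 / 12))
            * ((Real.sqrt (Fintype.card ι) * M₂ * ∑ j, ‖b j‖) * B₀))
          (conv2ConstR cP (Λ * Real.exp (1 / 12 * δ₀ * (2 * (2 * ((d : ℝ) + 1))))) M₂ (∑ j, ‖b j‖) (Real.sqrt (Fintype.card ι))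
            (2 * ((d : ℝ) + 1)) (5 * δ₀ / 6) (2 * δ₀ / 3) (1 / 4) Λ Λ (B6.c1 dL δ₀ (1 / 12)) * ((Real.sqrt (Fintype.card ι) * M₂ * ∑ j, ‖b j‖) * B₀))) := rfl
  revert h0 h1 h2 h4 hLL hRR hBc0 hBL0 hBR0 hBx0 hBx
  generalize convConst2L2 cP M₂ (∑ j, ‖b j‖) (Real.sqrt (Fintype.card ι)) d dL δ₀ Λ B₀ = Bx
  generalize convConstL2 M₂ (∑ j, ‖b j‖) (Real.sqrt (Fintype.card ι)) d dL δ₀ Λ B₀ = Bc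
  generalize conv2ConstL cP M₂ (∑ j, ‖b j‖) (Real.sqrt (Fintype.card ι)) (2 * ((d : ℝ) + 1)) δ₀ (5 * δ₀ / 6) (1 / 4) Λ Λ (B6.c1 dL δ₀ (1 / 12))
    * ((Real.sqrt (Fintype.card ι) * M₂ * ∑ j, ‖b j‖) * B₀) = BL
  generalize conv2ConstR cP (Λ * Real.exp (1 / 12 * δ₀ * (2 * (2 * ((d : ℝ) + 1))))) M₂ (∑ j, ‖b j‖) (Real.sqrt (Fintype.card ι))
    (2 * ((d : ℝ) + 1)) (5 * δ₀ / 6) (2 * δ₀ / 3) (1 / 4) Λ Λ (B6.c1 dL δ₀ (1 / 12)) * ((Real.sqrt (Fintype.card ι) * M₂ * ∑ j, ‖b j‖) * B₀) = BR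
  intro h0 h1 h2 h4 hLL hRR hBc0 hBL0 hBR0 hBx0 hBx
  have hlen : ∀ y : (geo9Y x).Site, 0 < (geo9Y x).len y := geo9Y_len_pos x
  have hdnn : ∀ y y' : (geo9Y x).Site, 0 ≤ (geo9Y x).dist y y' := geo9Y_dist_nonneg x
  have hwℓ : ∀ p : (geo9Y x).Site, 0 ≤ (geo9Y x).len p := fun p => (hlen p).le
  have hBc_le : Bc ≤ Bx := by rw [hBx]; exact le_max_left _ _
  have hBL_le : BL ≤ Bx := by rw [hBx]; exact (le_max_left _ _).trans (le_max_right _ _)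
  have hBR_le : BR ≤ Bx := by rw [hBx]; exact (le_max_right _ _).trans (le_max_right _ _)
  -- every family up to the common constant `Bx` and the common rate `δ₀/2`
  have mono : ∀ {T : Module.End ℝ (SiteY x.toKIdx × ι → ℝ)} {B r : ℝ} (n : Fin 6) (w : (geo9Y x).Site → ℝ), (∀ p, 0 ≤ w p) → 0 ≤ B → B ≤ Bx → δ₀ / 2 ≤ r →
      (∀ p, w p = B9.pref6 ((geo9Y x).len p) n) →
      HasL2Majorant (g := toB6 (geo9Y x) (0 : ℝ) True) (fun p : SiteY x.toKIdx × ι => blkC x.toKIdx ιB p.1) T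
        (fun p q => B * w p * Real.exp (-(r * (geo9Y x).dist p q))) →
      HasL2Majorant (g := toB6 (geo9Y x) (0 : ℝ) True) (fun p : SiteY x.toKIdx × ι => blkC x.toKIdx ιB p.1) T
        (fun p q => Bx * B9.pref6 ((geo9Y x).len p) n * Real.exp (-(δ₀ / 2 * (geo9Y x).dist p q))) := by
    intro T B r n w hw hB hBx' hr hwn h
    have h' := hasL2Majorant_rate_mono (R := (0 : ℝ)) (H := True) (g := geo9Y x) _ B w hB hw hr hdnn h
    exact hasL2Majorant_mono (g := toB6 (geo9Y x) (0 : ℝ) True) _ h' fun p q => by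
      rw [← hwn p]; exact mul_le_mul_of_nonneg_right (mul_le_mul_of_nonneg_right hBx' (hw p)) (Real.exp_nonneg _)
  have hle : δ₀ / 2 ≤ δ₀ / 2 := le_rfl
  have hhalf₂ : δ₀ / 2 ≤ 2 * δ₀ / 3 := by linarith
  refine l2Block_kernelFamilyS_of_printWords x ιB b hι hM₂ hrepr (0 : ℝ) True (B := bg9Y 𝔸 G x) (fun U => U) (GpY x.toKIdx par) par hBx0
    (c := mulY x.toKIdx (fluct (kGeo x.toKIdx).eta a) U) ?_ (fun μ => ?_) (fun μ => ?_) (fun μ ν => ?_) (fun μ ν => ?_) (fun μ ν => ?_)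
  · exact mono 0 (fun p => (geo9Y x).len p ^ 2) (fun p => sq_nonneg _) hBc0 hBc_le hle (fun p => rfl) h0
  · have h := h1 (Sum.inl μ)
    rw [← B9Eq352DivFormLetters.conj_mul] at h
    exact mono 1 (fun p => (geo9Y x).len p) hwℓ hBc0 hBc_le hle (fun p => rfl) h
  · have h := h2 (Sum.inr μ)
    rw [← B9Eq352DivFormLetters.conj_mul] at h
    exact mono 2 (fun p => (geo9Y x).len p) hwℓ hBc0 hBc_le hle (fun p => rfl) h
  · have h := hLL μ ν
    rw [← B9Eq352DivFormLetters.conj_mul, ← B9Eq352DivFormLetters.conj_mul] at h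
    exact mono 3 (fun _ => (1 : ℝ)) (fun _ => zero_le_one) hBL0 hBL_le hhalf₂ (fun p => rfl) h
  · have h := h4 (Sum.inl μ) (Sum.inr ν)
    rw [← B9Eq352DivFormLetters.conj_mul, ← B9Eq352DivFormLetters.conj_mul] at h
    exact mono 4 (fun _ => (1 : ℝ)) (fun _ => zero_le_one) hBc0 hBc_le hle (fun p => rfl) h
  · have h := hRR μ ν
    rw [← B9Eq352DivFormLetters.conj_mul, ← B9Eq352DivFormLetters.conj_mul] at h
    exact mono 5 (fun _ => (1 : ℝ)) (fun _ => zero_le_one) hBR0 hBR_le hhalf₂ (fun p => rfl) h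

end Hout



/-! ## §3  ★★ hin assembled: every member of the augmented `KSC₃` at a base from the record's (3.46) block -/

section Members

variable (G : Subgroup 𝔸ˣ) (x : MemberY d ℓ hd hL b₀ b₁ Mstar) (par : SiteParY 𝔸 x.toKIdx) {ι : Type} [Fintype ι] [DecidableEq ι]
  (b : Module.Basis ι ℝ 𝔸) (ιB : BlkY x.toKIdx → IBondY x.toKIdx) [Fintype (geo9Y x).Site] [DecidableEq (geo9Y x).Site]
  (C37 C38 : ℝ → CfgY 𝔸 x.toKIdx → AfldY 𝔸 x.toKIdx → Prop)

omit [NormOneClass 𝔸] in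
/-- ★ **THE AUGMENTED MEMBERS 3 AND 5 OF `KSC₃` AT A BASE** (the two second-order words in all patterns), completing
`B9SectBL2TransferInY.l2_KSC₃_base_of_record` (members 0, 1, 2, 4): from the record's (3.46) block `(B₀, δ₀)` at the `G`-valued base `U` and the
plaquette law `PlaqLawY c_P U`, with constant `c_L·cross2ConstL2` and rate `δ₀/2`.
[cite: Balaban1985BackgroundPropagators, Thm 3.1 (3.46) p.398, p.398 (first remark), p.404 (after (3.69)); Balaban1984PropagatorsII, Prop. 2.6 (2.140)–(2.141) p.247] -/
theorem l2_KSC₃_base_of_record₃₅ (hι : ∀ s : BlkY x.toKIdx, β x.toKIdx.hN x.toKIdx.D x.toKIdx.hk (ιB s) = s)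
    (hG1 : ∀ u : 𝔸ˣ, u ∈ G → ‖(u : 𝔸)‖ ≤ 1) {M₂ : ℝ} (hM₂ : 0 ≤ M₂) (hrepr : ∀ (v : 𝔸) (j : ι), |b.repr v j| ≤ M₂ * ‖v‖)
    {δ₀ : ℝ} (hδ₀ : 0 < δ₀) {dL : ℕ} (h261 : Ineq261 dL (toB6 (geo9Y x) (0 : ℝ) True) δ₀ (1 / 12)) {Λ : ℝ} (hΛ : 1 ≤ Λ)
    (hT1 : ScaleTransfer (geo9Y x) δ₀ (1 / 12) Λ (fun a => (geo9Y x).len a))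
    (hTi2 : ScaleTransfer (geo9Y x) δ₀ (1 / 12) Λ (fun a => ((geo9Y x).len a)⁻¹ ^ 2))
    {cP : ℝ} (hcP : 0 ≤ cP) {B₀ : ℝ} (hB₀ : 0 ≤ B₀) {U : CfgY 𝔸 x.toKIdx} (hU : GVal G x.toKIdx U) (hplaq : PlaqLawY x ιB cP U)
    (hL2 : L2Block (kernelFamilyS x.toKIdx (bg9Y 𝔸 G x) (fun U => U) (GpY x.toKIdx par) par) B₀ δ₀ U)
    (n : Fin 6) (hn : n = 3 ∨ n = 5)
    (lam : (geo9Y x).Loc) (h : (geo9Y x).Cut) (y y' : IBondY x.toKIdx) (hcut : (geo9Y x).cutIn h y) (hsupp : (geo9Y x).suppIn lam y') :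
    (KSC₃ G x par C37 C38).l2 n (.base U) lam h ≤
      ((Real.sqrt (Fintype.card ι) * M₂ * ∑ j, ‖b j‖) * cross2ConstL2 cP M₂ (∑ j, ‖b j‖) (Real.sqrt (Fintype.card ι)) d dL δ₀ Λ B₀) *
        B9.pref6 ((geo9Y x).len y) n * (geo9Y x).cutSup h * Real.exp (-(δ₀ / 2 * (geo9Y x).dist y y')) * (geo9Y x).l2Norm lam := by
  obtain ⟨h3, h5⟩ := hasL2Majorant_secondPatterns_of_l2Block G x par b ιB hι hG1 hM₂ hrepr hδ₀ h261 hΛ hT1 hTi2 hcP hB₀ hU hplaq hL2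
  have hSb : 0 ≤ ∑ j, ‖b j‖ := Finset.sum_nonneg fun j _ => norm_nonneg _
  have hBx0 : 0 ≤ cross2ConstL2 cP M₂ (∑ j, ‖b j‖) (Real.sqrt (Fintype.card ι)) d dL δ₀ Λ B₀ :=
    cross2ConstL2_nonneg hcP hM₂ hSb (Real.sqrt_nonneg _) d dL δ₀ (le_trans zero_le_one hΛ) hB₀
  rw [KSC₃_l2]
  refine l2AugS_le_of_hasL2Majorant_wordL x ιB b hι hM₂ hrepr (0 : ℝ) True (B := (codingYx G x C37 C38).bg) (fun c => c) (GpY x.toKIdx par) hBx0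
    (c := .base U) n (fun k l => ?_) lam h y y' hcut hsupp
  rcases hn with rfl | rfl
  · exact h3 k l
  · exact h5 k l

omit [NormOneClass 𝔸] in
/-- ★★ **hin FOR THE `L²` MEMBER: THE (3.46) BLOCK OF THE AUGMENTED FAMILY `KSC₃` AT A BASE FROM THE RECORD's** — all six members, every orientation
pattern, from the record's block `(B₀, δ₀)` at the `G`-valued base `U`, the plaquette law `PlaqLawY c_P U`, Lemma 2.1 of [4] at `(δ₀, 1/12)` and the scale
transfers of `ℓ`, `ℓ⁻²` (one constant `Λ ≧ 1`): `L2Block (KSC₃ …) (c_L·max(crossConstL2, cross2ConstL2)) (δ₀/2) (.base U)`.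
[cite: Balaban1985BackgroundPropagators, Thm 3.1 (3.46) p.398, p.398 (first remark), p.404 (after (3.69)); Balaban1984PropagatorsII, Prop. 2.6 (2.140)–(2.141) p.247, Lemma 2.1 p.234] -/
theorem l2Block_KSC₃_base_of_record (hι : ∀ s : BlkY x.toKIdx, β x.toKIdx.hN x.toKIdx.D x.toKIdx.hk (ιB s) = s)
    (hG1 : ∀ u : 𝔸ˣ, u ∈ G → ‖(u : 𝔸)‖ ≤ 1) {M₂ : ℝ} (hM₂ : 0 ≤ M₂) (hrepr : ∀ (v : 𝔸) (j : ι), |b.repr v j| ≤ M₂ * ‖v‖)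
    {δ₀ : ℝ} (hδ₀ : 0 < δ₀) {dL : ℕ} (h261 : Ineq261 dL (toB6 (geo9Y x) (0 : ℝ) True) δ₀ (1 / 12)) {Λ : ℝ} (hΛ : 1 ≤ Λ)
    (hT1 : ScaleTransfer (geo9Y x) δ₀ (1 / 12) Λ (fun a => (geo9Y x).len a))
    (hTi2 : ScaleTransfer (geo9Y x) δ₀ (1 / 12) Λ (fun a => ((geo9Y x).len a)⁻¹ ^ 2))
    {cP : ℝ} (hcP : 0 ≤ cP) {B₀ : ℝ} (hB₀ : 0 ≤ B₀) {U : CfgY 𝔸 x.toKIdx} (hU : GVal G x.toKIdx U) (hplaq : PlaqLawY x ιB cP U)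
    (hL2 : L2Block (kernelFamilyS x.toKIdx (bg9Y 𝔸 G x) (fun U => U) (GpY x.toKIdx par) par) B₀ δ₀ U) :
    L2Block (KSC₃ G x par C37 C38)
      ((Real.sqrt (Fintype.card ι) * M₂ * ∑ j, ‖b j‖) *
        max (crossConstL2 M₂ (∑ j, ‖b j‖) (Real.sqrt (Fintype.card ι)) d dL δ₀ Λ B₀)
          (cross2ConstL2 cP M₂ (∑ j, ‖b j‖) (Real.sqrt (Fintype.card ι)) d dL δ₀ Λ B₀)) (δ₀ / 2) (.base U) := by
  intro n lam h y y' hcut hsupp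
  have hcL : 0 ≤ Real.sqrt (Fintype.card ι) * M₂ * ∑ j, ‖b j‖ := by
    have := Finset.sum_nonneg fun j (_ : j ∈ Finset.univ) => norm_nonneg (b j); positivity
  have hrest : 0 ≤ B9.pref6 ((geo9Y x).len y) n * (geo9Y x).cutSup h * Real.exp (-(δ₀ / 2 * (geo9Y x).dist y y')) * (geo9Y x).l2Norm lam := by
    have := pref6_nonneg (geo9Y_len_pos x y).le n
    have := B9GeoNormsKLevelV1.geo9K_cutSup_nonneg x.toKIdx h
    have := B9GeoNormsKLevelV1.geo9K_l2Norm_nonneg x.toKIdx lam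
    positivity
  have up : ∀ {Bc : ℝ}, Bc ≤ max (crossConstL2 M₂ (∑ j, ‖b j‖) (Real.sqrt (Fintype.card ι)) d dL δ₀ Λ B₀)
        (cross2ConstL2 cP M₂ (∑ j, ‖b j‖) (Real.sqrt (Fintype.card ι)) d dL δ₀ Λ B₀) →
      (KSC₃ G x par C37 C38).l2 n (.base U) lam h ≤ ((Real.sqrt (Fintype.card ι) * M₂ * ∑ j, ‖b j‖) * Bc) *
        B9.pref6 ((geo9Y x).len y) n * (geo9Y x).cutSup h * Real.exp (-(δ₀ / 2 * (geo9Y x).dist y y')) * (geo9Y x).l2Norm lam →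
      (KSC₃ G x par C37 C38).l2 n (.base U) lam h ≤ ((Real.sqrt (Fintype.card ι) * M₂ * ∑ j, ‖b j‖) *
        max (crossConstL2 M₂ (∑ j, ‖b j‖) (Real.sqrt (Fintype.card ι)) d dL δ₀ Λ B₀)
          (cross2ConstL2 cP M₂ (∑ j, ‖b j‖) (Real.sqrt (Fintype.card ι)) d dL δ₀ Λ B₀)) *
        B9.pref6 ((geo9Y x).len y) n * (geo9Y x).cutSup h * Real.exp (-(δ₀ / 2 * (geo9Y x).dist y y')) * (geo9Y x).l2Norm lam := by
    intro Bc hBc hle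
    refine hle.trans ?_
    have h1 : (Real.sqrt (Fintype.card ι) * M₂ * ∑ j, ‖b j‖) * Bc ≤ (Real.sqrt (Fintype.card ι) * M₂ * ∑ j, ‖b j‖) *
        max (crossConstL2 M₂ (∑ j, ‖b j‖) (Real.sqrt (Fintype.card ι)) d dL δ₀ Λ B₀)
          (cross2ConstL2 cP M₂ (∑ j, ‖b j‖) (Real.sqrt (Fintype.card ι)) d dL δ₀ Λ B₀) := mul_le_mul_of_nonneg_left hBc hcL
    calc _ = ((Real.sqrt (Fintype.card ι) * M₂ * ∑ j, ‖b j‖) * Bc) *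
          (B9.pref6 ((geo9Y x).len y) n * (geo9Y x).cutSup h * Real.exp (-(δ₀ / 2 * (geo9Y x).dist y y')) * (geo9Y x).l2Norm lam) := by ring
      _ ≤ ((Real.sqrt (Fintype.card ι) * M₂ * ∑ j, ‖b j‖) *
          max (crossConstL2 M₂ (∑ j, ‖b j‖) (Real.sqrt (Fintype.card ι)) d dL δ₀ Λ B₀)
            (cross2ConstL2 cP M₂ (∑ j, ‖b j‖) (Real.sqrt (Fintype.card ι)) d dL δ₀ Λ B₀)) *
          (B9.pref6 ((geo9Y x).len y) n * (geo9Y x).cutSup h * Real.exp (-(δ₀ / 2 * (geo9Y x).dist y y')) * (geo9Y x).l2Norm lam) :=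
        mul_le_mul_of_nonneg_right h1 hrest
      _ = _ := by ring
  have hA := fun m hm => B9SectBL2TransferInY.l2_KSC₃_base_of_record G x par b ιB C37 C38 hι hG1 hM₂ hrepr hδ₀ h261 hΛ hT1 hB₀ hU hL2 m hm lam h y y'
    hcut hsupp
  have hB := fun m hm => l2_KSC₃_base_of_record₃₅ G x par b ιB C37 C38 hι hG1 hM₂ hrepr hδ₀ h261 hΛ hT1 hTi2 hcP hB₀ hU hplaq hL2 m hm lam h y y'
    hcut hsupp
  match n with
  | 0 => exact up (le_max_left _ _) (hA 0 (Or.inl rfl))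
  | 1 => exact up (le_max_left _ _) (hA 1 (Or.inr (Or.inl rfl)))
  | 2 => exact up (le_max_left _ _) (hA 2 (Or.inr (Or.inr (Or.inl rfl))))
  | 3 => exact up (le_max_right _ _) (hB 3 (Or.inl rfl))
  | 4 => exact up (le_max_left _ _) (hA 4 (Or.inr (Or.inr (Or.inr rfl))))
  | 5 => exact up (le_max_right _ _) (hB 5 (Or.inr rfl))

end Members

/-! ## §4  The transported plaquette law from a bound on the plaquette variables (the bridge to `B9Eq335CoveragePAtLettersY`) -/

section PlaqFromHolonomy

variable (G : Subgroup 𝔸ˣ) (x : MemberY d ℓ hd hL b₀ b₁ Mstar) (ιB : BlkY x.toKIdx → IBondY x.toKIdx)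

omit [NormedAlgebra ℂ 𝔸] [CompleteSpace 𝔸] [NormOneClass 𝔸] [FiniteDimensional ℝ 𝔸] in
/-- transports around a plaquette: for units `a, b` of norm `≦ 1` with inverses of norm `≦ 1`, `‖R(a)X − R(b)X‖ ≦ 2‖ab⁻¹ − 1‖·‖X‖`
(`R(a)X − R(b)X = (ab⁻¹ − 1)·R(b)X·(ab⁻¹)⁻¹ + R(b)X·((ab⁻¹)⁻¹ − 1)`). [cite: Balaban1985BackgroundPropagators, p.390, (3.5) p.391, p.404 (after (3.69)), bookkeeping] -/
theorem norm_R_sub_R_le_of_holonomy (a b : 𝔸ˣ) (ha : ‖(a : 𝔸)‖ ≤ 1 ∧ ‖((a⁻¹ : 𝔸ˣ) : 𝔸)‖ ≤ 1) (hb : ‖(b : 𝔸)‖ ≤ 1 ∧ ‖((b⁻¹ : 𝔸ˣ) : 𝔸)‖ ≤ 1) (X : 𝔸) :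
    ‖R a X - R b X‖ ≤ 2 * ‖((a * b⁻¹ : 𝔸ˣ) : 𝔸) - 1‖ * ‖X‖ := by
  set P : 𝔸ˣ := a * b⁻¹ with hP
  have haP : a = P * b := by rw [hP, inv_mul_cancel_right]
  have e : R a X - R b X = (((P : 𝔸ˣ) : 𝔸) - 1) * R b X * ((P⁻¹ : 𝔸ˣ) : 𝔸) + R b X * (((P⁻¹ : 𝔸ˣ) : 𝔸) - 1) := by
    rw [haP, B9Eq39Adjoint.R_mul, B9Eq39Adjoint.R_def P]
    noncomm_ring
  have hPn : ‖((P⁻¹ : 𝔸ˣ) : 𝔸)‖ ≤ 1 := by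
    rw [hP, mul_inv_rev, inv_inv, Units.val_mul]; exact (norm_mul_le _ _).trans (mul_le_one₀ hb.1 (norm_nonneg _) ha.2)
  have hPi : ‖((P⁻¹ : 𝔸ˣ) : 𝔸) - 1‖ ≤ ‖((P : 𝔸ˣ) : 𝔸) - 1‖ := by
    have e1 : ((P⁻¹ : 𝔸ˣ) : 𝔸) - 1 = ((P⁻¹ : 𝔸ˣ) : 𝔸) * (1 - (P : 𝔸)) := by rw [mul_sub, mul_one, Units.inv_mul]
    rw [e1]
    calc _ ≤ ‖((P⁻¹ : 𝔸ˣ) : 𝔸)‖ * ‖1 - ((P : 𝔸ˣ) : 𝔸)‖ := norm_mul_le _ _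
      _ ≤ 1 * ‖1 - ((P : 𝔸ˣ) : 𝔸)‖ := mul_le_mul_of_nonneg_right hPn (norm_nonneg _)
      _ = _ := by rw [one_mul, norm_sub_rev]
  have hRb : ‖R b X‖ ≤ ‖X‖ := by
    have := B9Eq371Composition.norm_R_le_sq b hb.1 hb.2 X; rwa [one_pow, one_mul] at this
  rw [e]
  calc _ ≤ ‖(((P : 𝔸ˣ) : 𝔸) - 1) * R b X * ((P⁻¹ : 𝔸ˣ) : 𝔸)‖ + ‖R b X * (((P⁻¹ : 𝔸ˣ) : 𝔸) - 1)‖ := norm_add_le _ _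
    _ ≤ ‖((P : 𝔸ˣ) : 𝔸) - 1‖ * ‖R b X‖ * ‖((P⁻¹ : 𝔸ˣ) : 𝔸)‖ + ‖R b X‖ * ‖((P⁻¹ : 𝔸ˣ) : 𝔸) - 1‖ :=
        add_le_add ((norm_mul_le _ _).trans (mul_le_mul_of_nonneg_right (norm_mul_le _ _) (norm_nonneg _))) (norm_mul_le _ _)
    _ ≤ ‖((P : 𝔸ˣ) : 𝔸) - 1‖ * ‖X‖ * 1 + ‖X‖ * ‖((P : 𝔸ˣ) : 𝔸) - 1‖ := by gcongr
    _ = 2 * ‖((P : 𝔸ˣ) : 𝔸) - 1‖ * ‖X‖ := by ring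

omit [NormOneClass 𝔸] [FiniteDimensional ℝ 𝔸] in
/-- ★ **THE PLAQUETTE LAW FROM A BOUND ON THE PLAQUETTE VARIABLES**: at a `G`-valued configuration (`G` of norm `≦ 1`), a bound
`‖U_μ(z)U_ν(z+e_μ)U_μ(z+e_ν)⁻¹U_ν(z)⁻¹ − 1‖ ≦ c·(η/ℓ(y(z)))²` for every plaquette (print p. 404 after (3.69): «|Re(U′U)(∂p) − 1|, |Im(U′U)(∂p)| ≦ O(1)(Mα₀ + α₁)ξ²»;
for the P-class of (3.35) it is `B9Eq335CoveragePAtLettersY.norm_holY_sub_one_le_of_reg335Cube` with the covering `exists_cubeClassP_plaquette`) gives `PlaqLawY (2c) U`.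
[cite: Balaban1985BackgroundPropagators, p.404 (after (3.69)), (3.35) p.396, (3.5) p.391] -/
theorem plaqLawY_of_holonomy_bound (hG1 : ∀ u : 𝔸ˣ, u ∈ G → ‖(u : 𝔸)‖ ≤ 1) {U : CfgY 𝔸 x.toKIdx} (hU : GVal G x.toKIdx U) {c : ℝ}
    (h : ∀ (μ ν : Fin (d + 1)) (z : SiteY x.toKIdx),
      ‖((UboxY x.toKIdx U μ z * UboxY x.toKIdx U ν (shiftY x.toKIdx μ z) * (UboxY x.toKIdx U μ (shiftY x.toKIdx ν z))⁻¹ * (UboxY x.toKIdx U ν z)⁻¹ : 𝔸ˣ) : 𝔸) - 1‖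
        ≤ c * ((kGeo x.toKIdx).eta * ((geo9Y x).len (blkC x.toKIdx ιB z))⁻¹) ^ 2) :
    PlaqLawY x ιB (2 * c) U := by
  intro μ ν z X
  have hρu : ∀ (κ' : Fin (d + 1)) (w : SiteY x.toKIdx), ‖((UboxY x.toKIdx U κ' w : 𝔸ˣ) : 𝔸)‖ ≤ 1 ∧ ‖(((UboxY x.toKIdx U κ' w)⁻¹ : 𝔸ˣ) : 𝔸)‖ ≤ 1 :=
    fun κ' w => norm_le_one_and_inv_of_mem G hG1 (hU κ' _ : UboxY x.toKIdx U κ' w ∈ G)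
  have hpair : ∀ (a₁ a₂ : 𝔸ˣ), (‖(a₁ : 𝔸)‖ ≤ 1 ∧ ‖((a₁⁻¹ : 𝔸ˣ) : 𝔸)‖ ≤ 1) → (‖(a₂ : 𝔸)‖ ≤ 1 ∧ ‖((a₂⁻¹ : 𝔸ˣ) : 𝔸)‖ ≤ 1) →
      ‖((a₁ * a₂ : 𝔸ˣ) : 𝔸)‖ ≤ 1 ∧ ‖(((a₁ * a₂)⁻¹ : 𝔸ˣ) : 𝔸)‖ ≤ 1 := fun a₁ a₂ h₁ h₂ =>
    ⟨by rw [Units.val_mul]; exact (norm_mul_le _ _).trans (mul_le_one₀ h₁.1 (norm_nonneg _) h₂.1),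
     by rw [mul_inv_rev, Units.val_mul]; exact (norm_mul_le _ _).trans (mul_le_one₀ h₂.2 (norm_nonneg _) h₁.2)⟩
  have key := norm_R_sub_R_le_of_holonomy (UboxY x.toKIdx U μ z * UboxY x.toKIdx U ν (shiftY x.toKIdx μ z))
    (UboxY x.toKIdx U ν z * UboxY x.toKIdx U μ (shiftY x.toKIdx ν z)) (hpair _ _ (hρu μ z) (hρu ν _)) (hpair _ _ (hρu ν z) (hρu μ _)) X
  have hhol : (UboxY x.toKIdx U μ z * UboxY x.toKIdx U ν (shiftY x.toKIdx μ z)) * (UboxY x.toKIdx U ν z * UboxY x.toKIdx U μ (shiftY x.toKIdx ν z))⁻¹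
      = UboxY x.toKIdx U μ z * UboxY x.toKIdx U ν (shiftY x.toKIdx μ z) * (UboxY x.toKIdx U μ (shiftY x.toKIdx ν z))⁻¹ * (UboxY x.toKIdx U ν z)⁻¹ := by
    rw [mul_inv_rev]; group
  rw [hhol] at key
  refine key.trans ?_
  have hX : 0 ≤ ‖X‖ := norm_nonneg _
  calc 2 * ‖((UboxY x.toKIdx U μ z * UboxY x.toKIdx U ν (shiftY x.toKIdx μ z) * (UboxY x.toKIdx U μ (shiftY x.toKIdx ν z))⁻¹ * (UboxY x.toKIdx U ν z)⁻¹ : 𝔸ˣ) : 𝔸)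
        - 1‖ * ‖X‖ ≤ 2 * (c * ((kGeo x.toKIdx).eta * ((geo9Y x).len (blkC x.toKIdx ιB z))⁻¹) ^ 2) * ‖X‖ :=
        mul_le_mul_of_nonneg_right (mul_le_mul_of_nonneg_left (h μ ν z) (by norm_num)) hX
    _ = _ := by ring

end PlaqFromHolonomy

end Literature.MathematicalPhysics.QuantumFieldTheory.Balaban1983to89.B9SectBL2SecondOrderY

end
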